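import Mathlib.Algebra.BigOperators.Ring.Finset
import Mathlib.Algebra.Order.BigOperators.Ring.Finset
import Mathlib.Data.Fintype.BigOperators
import Mathlib.Algebra.BigOperators.Field
import Mathlib.Data.Real.Basic
import Mathlib.Tactic.Linarith
import Mathlib.Tactic.Ring
import Mathlib.Tactic.FieldSimp
import Mathlib.Tactic.DeriveFintype
import Literature.Computability.Complexity.CNF
import Literature.Computability.Complexity.DecisionTree
import HarnessLib

/-!
# Håstad's multi-switching lemma (canonical common partial decision trees of families of DNFs)

Topic `Literature/Computability/Complexity`. This file proves, with explicit constants, the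
**multi-switching lemma** of Håstad (*On the correlation of parity and small-depth circuits*,
SIAM J. Comput. 43 (2014), Lemma 3.8), in the form quoted by Tal (*Tight bounds on the Fourier
spectrum of AC⁰*, CCC 2017, Lemma 3.5 of the full version ECCC TR14-174): for DNFs `F₁, …, F_m` of
width `≤ t` and a random restriction `ρ ∼ R_p`, the probability that the family `(F_i|ρ)_i` is
not computable by a common `ℓ`-partial decision tree of depth `< D` is exponentially small in `D`,
with only `(m+1)^{D/(ℓ+1)+1}` (not `m^D`) dependence on the number of formulas:

* `multiSwitching_count`: `Pr_{ρ∼R_p}[ccDepth ≥ D] ≤ (m+1)^{⌊(D-1)/(ℓ+1)⌋+1} (32(t+1)+1)^D (p/(1-p))^D`;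
* `multiSwitching`: for `m + 1 ≤ 2^{ℓ+1}` and `p ≤ 1/2`, `Pr[ccDepth ≥ D] ≤ (m+1) (132(t+1)p)^D`.

Here `ccDepth ℓ F n ρ` is the depth of **Håstad's canonical common `ℓ`-partial decision tree**:
as long as some `F_i|σ` has canonical decision tree (`cdt`) deeper than `ℓ`, query (in the common
tree, exploring all answers) the variables of a canonical long path of that formula; at the leaves
`τ` every `F_i|τ` has `cdt ≤ ℓ` (`cdt_le_of_mem_procLeaves`), hence an ordinary decision tree of
depth `≤ ℓ` (`exists_decisionTree_of_cdt_le`, trees of `DecisionTree.lean`). The ordinary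
switching lemma is the case `m = 1`.

## The model

* `PAssign n`: partial assignments `σ = (dom, val)` with a *total* value function (junk off
  `dom`); `σ.apply x` is the restricted input, `σ.fix S a` fixes a further block. The random
  restriction `R_p` is the weight `rrWeight p σ = (1-p)^{|dom|} p^{n-|dom|} 2^{-n}` on this product
  type (`sum_rrWeight`): each variable is fixed independently with probability `1 - p`, values
  uniform — the law of the induced restriction is Håstad's `R_p` [Håstad 1986, §2], and restricted
  functions `x ↦ f (σ.apply x) = f (dom.piecewise val x)` are in the `Finset.piecewise` form of
  `Literature/Computability/Complexity/BooleanFourier` (Fourier coefficients of restrictions).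
* DNFs are `CNF (Fin n)` of `CNF.lean` read disjunctively (`CNF.evalDNF`); terms are required to
  have pairwise distinct variables (`VarNodup`) and width `≤ t`.
* `cdtF fuel F σ` / `cdt`: depth of the canonical decision tree of `F|σ` (first live term, query
  its free variables, continue on the answers not satisfying it) [Beame 1994, §3]; `PathValid`:
  its full paths, by stages.
* `procDepth Q` / `procLeaves Q`: adaptive processes querying blocks `Q σ` of variables;
  `swQuery ℓ F`: the block of the common tree; `ccDepth`.

## The proof (Razborov–Beame encoding, extended to segments as in Håstad 2014, §3)

A branch of the common tree of depth `≥ D` yields a *witness* (`WitValid`, `exists_witness`): a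
list of *segments* (formula index, full canonical long path of that formula from the current
state — more than `ℓ` variables, so at most `(D-1)/(ℓ+1)+1` segments —, the branch's answers), the
last one truncated to reach exactly `D` variables (`truncPath`). The injection
`ρ ↦ (code, ρ*)` (`badCode`): `ρ*` fixes the `D` variables so that each examined term becomes
satisfied on its queried variables (`starVal`); the code records, per segment, the formula index,
and per variable its position in the examined term, the path answer, the branch answer and the
junk value of `ρ` (`Entry`, `32(t+1)+1` possibilities after flattening with block marks, `flatL`).
The decoder (`decWit`, correctness `decWit_encWit`) recovers the terms one by one as first live
terms of hybrid restrictions (`firstLive_hybrid`), hence the variables, hence `ρ`. Since `ρ*` has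
`D` more fixed variables, `(1-p)^D w(ρ) = p^D w(ρ*)` (`rrWeight_fix`), and summing over the
injective image gives the bound (`multiSwitching_count`).

## References

* J. Håstad, *On the correlation of parity and small-depth circuits*, SIAM J. Comput. 43 (2014),
  §3, Lemma 3.8 [Hastad2014].
* A. Tal, *Tight bounds on the Fourier spectrum of AC⁰*, CCC 2017 (ECCC TR14-174), Lemma 3.5 [Tal2017].
* P. Beame, *A switching lemma primer*, Tech. report, Univ. of Washington (1994), §3 (Razborov's
  proof of Håstad's switching lemma) [Beame1994].
* J. Håstad, *Computational limitations of small-depth circuits*, PhD thesis, MIT (1986), §2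
  (random restrictions `R_p`) [Hastad1986].
-/

noncomputable section

namespace Literature.Computability.Complexity

open Finset

variable {n : ℕ}

/-! ### Partial assignments -/

/-- A partial assignment (restriction) of the variables `Fin n`: the set `dom` of fixed
variables and their values `val` (the values of `val` off `dom` are irrelevant junk, kept so
that the type is a plain product; the random restriction `R_p` weights them uniformly).
[cite: Hastad1986, §2] -/
@[ext]
structure PAssign (n : ℕ) where
  /-- the fixed variables -/
  dom : Finset (Fin n)
  /-- their values (junk off `dom`) -/
  val : Fin n → Bool
  deriving DecidableEq, Fintype

namespace PAssign

/-- The input seen by a restricted function: fixed variables take their fixed values, the others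
are read from `x` (`f|σ (x) = f (σ.apply x)`). [cite: Hastad1986, §2] -/
def apply (σ : PAssign n) (x : Fin n → Bool) : Fin n → Bool := σ.dom.piecewise σ.val x

/-- Fix, in addition, the variables of `S` to the values `a`. [cite: Hastad1986, §2] -/
def fix (σ : PAssign n) (S : Finset (Fin n)) (a : Fin n → Bool) : PAssign n :=
  ⟨σ.dom ∪ S, S.piecewise a σ.val⟩

/-- Change the values on `S` to `a` (domain unchanged). [folklore] -/
def setVals (σ : PAssign n) (S : Finset (Fin n)) (a : Fin n → Bool) : PAssign n :=
  ⟨σ.dom, S.piecewise a σ.val⟩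

/-- The free (starred) variables. [cite: Hastad1986, §2] -/
def free (σ : PAssign n) : Finset (Fin n) := univ \ σ.dom

/-- Membership in the free set. [folklore] -/
@[simp] theorem mem_free {σ : PAssign n} {i : Fin n} : i ∈ σ.free ↔ i ∉ σ.dom := by
  simp [free]

/-- The domain after fixing a block. [folklore] -/
@[simp] theorem fix_dom (σ : PAssign n) (S : Finset (Fin n)) (a : Fin n → Bool) :
    (σ.fix S a).dom = σ.dom ∪ S := rfl

/-- The values after fixing a block. [folklore] -/
theorem fix_val (σ : PAssign n) (S : Finset (Fin n)) (a : Fin n → Bool) (i : Fin n) :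
    (σ.fix S a).val i = if i ∈ S then a i else σ.val i := by
  simp [fix, Finset.piecewise]

/-- `setVals` keeps the domain. [folklore] -/
@[simp] theorem setVals_dom (σ : PAssign n) (S : Finset (Fin n)) (a : Fin n → Bool) :
    (σ.setVals S a).dom = σ.dom := rfl

/-- The values after `setVals`. [folklore] -/
theorem setVals_val (σ : PAssign n) (S : Finset (Fin n)) (a : Fin n → Bool) (i : Fin n) :
    (σ.setVals S a).val i = if i ∈ S then a i else σ.val i := by
  simp [setVals, Finset.piecewise]

/-- Unfolding the restricted input. [folklore] -/
theorem apply_apply (σ : PAssign n) (x : Fin n → Bool) (i : Fin n) :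
    σ.apply x i = if i ∈ σ.dom then σ.val i else x i := by
  simp [apply, Finset.piecewise]

/-- The number of free variables. [folklore] -/
theorem card_free (σ : PAssign n) : σ.free.card = n - σ.dom.card := by
  rw [free, Finset.card_sdiff_of_subset (Finset.subset_univ _), Finset.card_univ, Fintype.card_fin]

/-- The free set after fixing a block. [folklore] -/
theorem free_fix (σ : PAssign n) (S : Finset (Fin n)) (a : Fin n → Bool) :
    (σ.fix S a).free = σ.free \ S := by
  ext i; simp [free, not_or]

/-- Extending by a nonempty set of free variables strictly decreases the number of free variables. [folklore] -/
theorem card_free_fix_lt {σ : PAssign n} {S : Finset (Fin n)} (hS : S ⊆ σ.free) (hne : S.Nonempty)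
    (a : Fin n → Bool) : (σ.fix S a).free.card < σ.free.card := by
  rw [free_fix]
  exact Finset.card_lt_card ⟨Finset.sdiff_subset, fun h => by
    obtain ⟨i, hi⟩ := hne
    exact (Finset.mem_sdiff.1 (h (hS hi))).2 hi⟩

/-- Fixing a block of `|S|` free variables leaves `|free| - |S|` free variables. [folklore] -/
theorem card_free_fix {σ : PAssign n} {S : Finset (Fin n)} (hS : S ⊆ σ.free) (a : Fin n → Bool) :
    (σ.fix S a).free.card + S.card = σ.free.card := by
  rw [free_fix, Finset.card_sdiff_add_card_eq_card hS]

/-- Extending twice on disjoint... : values on `S` after a further extension off `S`. [folklore] -/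
theorem ext_fix_val_of_mem {σ : PAssign n} {S T : Finset (Fin n)} {a b : Fin n → Bool} {i : Fin n}
    (hi : i ∈ S) (hiT : i ∉ T) : ((σ.fix S a).fix T b).val i = a i := by
  simp [fix_val, hi, hiT]

/-- `(σ ⊕_W sv).setVals S a = (σ ⊕_S a) ⊕_{W \ S} sv` for `S ⊆ W`. [folklore] -/
theorem setVals_fix {σ : PAssign n} {S W : Finset (Fin n)} (hSW : S ⊆ W) (sv a : Fin n → Bool) :
    (σ.fix W sv).setVals S a = (σ.fix S a).fix (W \ S) sv := by
  ext i
  · simp only [setVals_dom, fix_dom, Finset.mem_union, Finset.mem_sdiff]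
    constructor
    · rintro (h | h)
      · exact Or.inl (Or.inl h)
      · by_cases hS : i ∈ S
        · exact Or.inl (Or.inr hS)
        · exact Or.inr ⟨h, hS⟩
    · rintro ((h | h) | ⟨h, _⟩)
      · exact Or.inl h
      · exact Or.inr (hSW h)
      · exact Or.inr h
  · simp only [setVals_val, fix_val, Finset.mem_sdiff]
    by_cases hS : i ∈ S <;> by_cases hW : i ∈ W <;> simp [hS, hW]

/-- `(σ ⊕_S a) ⊕_T b = σ ⊕_{S ∪ T} c` whenever `c = a` on `S`, `c = b` on `T \ S`... stated as:
extending on `S` then on `T` with the same value function. [folklore] -/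
theorem fix_fix_same (σ : PAssign n) (S T : Finset (Fin n)) (a : Fin n → Bool) :
    (σ.fix S a).fix T a = σ.fix (S ∪ T) a := by
  ext i
  · simp [Finset.union_assoc]
  · simp only [fix_val, Finset.mem_union]
    by_cases hS : i ∈ S <;> by_cases hT : i ∈ T <;> simp [hS, hT]

/-- Extending on `S` with `a` and on `T` with `b` equals one extension on `S ∪ T` with the
combined values when `S ∩ T = ∅`. [folklore] -/
theorem fix_fix_disjoint {σ : PAssign n} {S T : Finset (Fin n)} (h : Disjoint S T)
    (a b : Fin n → Bool) :
    (σ.fix S a).fix T b = σ.fix (S ∪ T) (S.piecewise a b) := by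
  ext i
  · simp [Finset.union_assoc]
  · simp only [fix_val, Finset.mem_union, Finset.piecewise]
    by_cases hS : i ∈ S <;> by_cases hT : i ∈ T <;> simp [hS, hT]
    exact absurd (Finset.disjoint_left.1 h hS) (not_not.2 hT)

/-- The restricted input after an extension by values agreeing with `x` on `S` is unchanged. [folklore] -/
theorem fix_apply_of_agree {σ : PAssign n} {S : Finset (Fin n)} (hS : S ⊆ σ.free) {a x : Fin n → Bool}
    (h : ∀ i ∈ S, a i = x i) : (σ.fix S a).apply x = σ.apply x := by
  funext i
  simp only [apply_apply, fix_dom, Finset.mem_union, fix_val]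
  by_cases hd : i ∈ σ.dom <;> by_cases hiS : i ∈ S <;> simp [hd, hiS, h i]
  exact absurd hd (mem_free.1 (hS hiS))

/-- The restricted input of an extension: `(σ ⊕_S a).apply x = σ.apply (S.piecewise a x)` when
`S` is disjoint from `σ.dom`. [folklore] -/
theorem fix_apply {σ : PAssign n} {S : Finset (Fin n)} (hS : S ⊆ σ.free) (a x : Fin n → Bool) :
    (σ.fix S a).apply x = σ.apply (S.piecewise a x) := by
  funext i
  simp only [apply_apply, fix_dom, Finset.mem_union, fix_val, Finset.piecewise]
  by_cases hd : i ∈ σ.dom <;> by_cases hiS : i ∈ S <;> simp [hd, hiS]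
  exact absurd hd (mem_free.1 (hS hiS))

/-- With no free variables the restricted input is constant. [folklore] -/
theorem apply_eq_val_of_free_eq_empty {σ : PAssign n} (h : σ.free = ∅) (x : Fin n → Bool) :
    σ.apply x = σ.val := by
  funext i
  rw [apply_apply, if_pos]
  by_contra hi
  have : i ∈ σ.free := mem_free.2 hi
  rw [h] at this; simp at this

end PAssign

open PAssign

/-! ### Terms under a partial assignment -/

/-- A term (`Clause (Fin n)`, read conjunctively) is *falsified* by `σ` if one of its literals is
fixed to false. [cite: Hastad1986, §2] -/
def Falsified (σ : PAssign n) (C : Clause (Fin n)) : Prop := ∃ l ∈ C, l.1 ∈ σ.dom ∧ σ.val l.1 ≠ l.2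

/-- Decidability (syntactic check). [folklore] -/
instance (σ : PAssign n) (C : Clause (Fin n)) : Decidable (Falsified σ C) :=
  inferInstanceAs (Decidable (∃ l ∈ C, l.1 ∈ σ.dom ∧ σ.val l.1 ≠ l.2))

/-- The free literals of a term under `σ`, in the order of the term. [cite: Hastad1986, §2] -/
def freeLits (σ : PAssign n) (C : Clause (Fin n)) : List (Literal (Fin n)) :=
  C.filter fun l => l.1 ∉ σ.dom

/-- The free variables of a term under `σ`, in the order of the term. [cite: Hastad1986, §2] -/
def freeVars (σ : PAssign n) (C : Clause (Fin n)) : List (Fin n) := (freeLits σ C).map Prod.fst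

/-- The first term of the DNF `F` not falsified by `σ` (the term examined by the canonical
decision tree of `F|σ`), if any. [cite: Beame1994, §3] -/
def firstLive (F : CNF (Fin n)) (σ : PAssign n) : Option (Clause (Fin n)) :=
  F.find? fun C => !decide (Falsified σ C)

/-- `a` makes all literals of `C` on the variables of `S` true. [cite: Beame1994, §3] -/
def SatOn (C : Clause (Fin n)) (S : Finset (Fin n)) (a : Fin n → Bool) : Prop :=
  ∀ l ∈ C, l.1 ∈ S → a l.1 = l.2

/-- Decidability (syntactic check). [folklore] -/
instance (C : Clause (Fin n)) (S : Finset (Fin n)) (a : Fin n → Bool) : Decidable (SatOn C S a) :=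
  inferInstanceAs (Decidable (∀ l ∈ C, l.1 ∈ S → a l.1 = l.2))

/-- The values making the literals of `C` true (Razborov's `σ`; junk `false` off the variables of
`C`, first occurrence if a variable is repeated). [cite: Beame1994, §3] -/
def polarity (C : Clause (Fin n)) (i : Fin n) : Bool :=
  match C.find? (fun l => l.1 = i) with
  | some l => l.2
  | none => false

/-- The position in `C` of the (first) literal on the variable `i` (`C.length` if none). [folklore] -/
def posOf (C : Clause (Fin n)) (i : Fin n) : ℕ := C.findIdx fun l => l.1 = i

/-- The variables of a term are pairwise distinct. [folklore] -/
def VarNodup (C : Clause (Fin n)) : Prop := (C.map Prod.fst).Nodup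

/-- Membership in the free literals. [folklore] -/
theorem mem_freeLits {σ : PAssign n} {C : Clause (Fin n)} {l : Literal (Fin n)} :
    l ∈ freeLits σ C ↔ l ∈ C ∧ l.1 ∉ σ.dom := by
  simp [freeLits]

/-- Membership in the free variables. [folklore] -/
theorem mem_freeVars {σ : PAssign n} {C : Clause (Fin n)} {i : Fin n} :
    i ∈ freeVars σ C ↔ ∃ b, (i, b) ∈ C ∧ i ∉ σ.dom := by
  constructor
  · intro h
    obtain ⟨l, hl, rfl⟩ := List.mem_map.1 h
    exact ⟨l.2, (mem_freeLits.1 hl).1, (mem_freeLits.1 hl).2⟩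
  · rintro ⟨b, hb, hd⟩
    exact List.mem_map.2 ⟨(i, b), mem_freeLits.2 ⟨hb, hd⟩, rfl⟩

/-- Free variables of a term are free. [folklore] -/
theorem freeVars_subset_free (σ : PAssign n) (C : Clause (Fin n)) :
    (freeVars σ C).toFinset ⊆ σ.free := by
  intro i hi
  obtain ⟨b, _, hd⟩ := mem_freeVars.1 (List.mem_toFinset.1 hi)
  exact mem_free.2 hd

/-- A term has at most `|C|` free variables. [folklore] -/
theorem length_freeVars_le (σ : PAssign n) (C : Clause (Fin n)) : (freeVars σ C).length ≤ C.length := by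
  rw [freeVars, List.length_map]; exact List.length_filter_le _ _

/-- The free variables of a repetition-free term are pairwise distinct. [folklore] -/
theorem VarNodup.freeVars_nodup {C : Clause (Fin n)} (h : VarNodup C) (σ : PAssign n) :
    (freeVars σ C).Nodup :=
  (List.Sublist.map Prod.fst (List.filter_sublist (l := C))).nodup h

/-- In a repetition-free term the literal on a variable is unique. [folklore] -/
theorem VarNodup.eq_of_mem {C : Clause (Fin n)} (h : VarNodup C) {l l' : Literal (Fin n)} (hl : l ∈ C)
    (hl' : l' ∈ C) (he : l.1 = l'.1) : l = l' := by
  obtain ⟨k, hk, rfl⟩ := List.getElem_of_mem hl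
  obtain ⟨k', hk', rfl⟩ := List.getElem_of_mem hl'
  have e : (C.map Prod.fst)[k]'(by simpa using hk) = (C.map Prod.fst)[k']'(by simpa using hk') := by
    simpa using he
  have hkk : k = k' := (List.Nodup.getElem_inj_iff h).1 e
  subst hkk; rfl

/-- `polarity` makes every literal of a repetition-free term true. [cite: Beame1994, §3] -/
theorem VarNodup.polarity_eq {C : Clause (Fin n)} (h : VarNodup C) {l : Literal (Fin n)} (hl : l ∈ C) :
    polarity C l.1 = l.2 := by
  unfold polarity
  cases hf : C.find? (fun l' => l'.1 = l.1) with
  | none => exact absurd (List.find?_eq_none.1 hf l hl) (by simp)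
  | some l' =>
    have hl'C : l' ∈ C := List.mem_of_find?_eq_some hf
    have hl'1 : l'.1 = l.1 := by simpa using List.find?_some hf
    simp only
    rw [h.eq_of_mem hl'C hl hl'1]

/-- The literal at position `posOf C i` is on the variable `i`, for `i` a variable of `C`. [folklore] -/
theorem getElem_posOf {C : Clause (Fin n)} {i : Fin n} (h : ∃ b, (i, b) ∈ C) :
    ∃ hlt : posOf C i < C.length, (C[posOf C i]'hlt).1 = i := by
  obtain ⟨b, hb⟩ := h
  unfold posOf
  have hlt : (C.findIdx fun l => l.1 = i) < C.length := by
    rw [List.findIdx_lt_length]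
    exact ⟨(i, b), hb, by simp⟩
  refine ⟨hlt, ?_⟩
  have := List.findIdx_getElem (xs := C) (p := fun l => decide (l.1 = i)) (w := hlt)
  exact of_decide_eq_true this

/-- The position of a variable of the term is within the term. [folklore] -/
theorem posOf_lt_length {C : Clause (Fin n)} {i : Fin n} (h : ∃ b, (i, b) ∈ C) : posOf C i < C.length :=
  (getElem_posOf h).1

/-- Characterisation of `firstLive F σ = some C`. [cite: Beame1994, §3] -/
theorem firstLive_eq_some_iff {F : CNF (Fin n)} {σ : PAssign n} {C : Clause (Fin n)} :
    firstLive F σ = some C ↔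
      ¬ Falsified σ C ∧ ∃ as bs, F = as ++ C :: bs ∧ ∀ T ∈ as, Falsified σ T := by
  unfold firstLive
  rw [List.find?_eq_some_iff_append]
  simp only [Bool.not_eq_eq_eq_not, Bool.not_true, decide_eq_false_iff_not, Bool.not_not,
    decide_eq_true_eq]

/-- There is no live term iff all terms are falsified. [cite: Beame1994, §3] -/
theorem firstLive_eq_none_iff {F : CNF (Fin n)} {σ : PAssign n} :
    firstLive F σ = none ↔ ∀ T ∈ F, Falsified σ T := by
  unfold firstLive
  rw [List.find?_eq_none]
  simp

/-- **Transfer of the first live term**: if every term falsified by `σ` is falsified by `τ` and the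
first live term of `σ` is not falsified by `τ`, it is the first live term of `τ`. [cite: Beame1994, §3] -/
theorem firstLive_transfer {F : CNF (Fin n)} {σ τ : PAssign n} {C : Clause (Fin n)}
    (hC : firstLive F σ = some C) (hmono : ∀ T, Falsified σ T → Falsified τ T) (hnot : ¬ Falsified τ C) :
    firstLive F τ = some C := by
  obtain ⟨_, as, bs, hF, has⟩ := firstLive_eq_some_iff.1 hC
  exact firstLive_eq_some_iff.2 ⟨hnot, as, bs, hF, fun T hT => hmono T (has T hT)⟩

/-- The first live term is a term of the DNF. [folklore] -/
theorem mem_of_firstLive {F : CNF (Fin n)} {σ : PAssign n} {C : Clause (Fin n)}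
    (hC : firstLive F σ = some C) : C ∈ F := by
  obtain ⟨_, as, bs, hF, _⟩ := firstLive_eq_some_iff.1 hC
  rw [hF]; simp

/-- An extension of `σ` off `σ.dom` falsifies every term `σ` falsifies. [folklore] -/
theorem Falsified.fix {σ : PAssign n} {C : Clause (Fin n)} (h : Falsified σ C) {S : Finset (Fin n)}
    (hS : S ⊆ σ.free) (a : Fin n → Bool) : Falsified (σ.fix S a) C := by
  obtain ⟨l, hl, hd, hv⟩ := h
  refine ⟨l, hl, Finset.mem_union_left _ hd, ?_⟩
  rw [fix_val, if_neg]
  · exact hv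
  · intro hlS; exact absurd hd (mem_free.1 (hS hlS))

/-- Changing values consistently on a block keeps a term falsified. [folklore] -/
theorem Falsified.setVals {σ : PAssign n} {C : Clause (Fin n)} (h : Falsified σ C) {S : Finset (Fin n)}
    {a : Fin n → Bool} (hS : ∀ l ∈ C, l.1 ∈ S → l.1 ∈ σ.dom → a l.1 = σ.val l.1) :
    Falsified (σ.setVals S a) C := by
  obtain ⟨l, hl, hd, hv⟩ := h
  refine ⟨l, hl, hd, ?_⟩
  rw [setVals_val]
  split_ifs with hlS
  · rw [hS l hl hlS hd]; exact hv
  · exact hv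

/-! ### The canonical decision tree of a DNF under a partial assignment -/

/-- The set of free variables of the term `C` under `σ`. [cite: Beame1994, §3] -/
def freeSet (σ : PAssign n) (C : Clause (Fin n)) : Finset (Fin n) := (freeVars σ C).toFinset

/-- The free set of a term consists of free variables. [folklore] -/
theorem freeSet_subset_free (σ : PAssign n) (C : Clause (Fin n)) : freeSet σ C ⊆ σ.free :=
  freeVars_subset_free σ C

/-- **Depth of the canonical decision tree** of the DNF `F` under `σ` (Håstad; Beame's
exposition): examine the first term not falsified; if none, or if it is already satisfied, stop;
otherwise query all its free variables and continue on every branch that does not satisfy it.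
`fuel` bounds the number of stages (`n` always suffices: each stage fixes a variable). [cite: Beame1994, §3] -/
def cdtF : ℕ → CNF (Fin n) → PAssign n → ℕ
  | 0, _, _ => 0
  | fuel + 1, F, σ =>
    match firstLive F σ with
    | none => 0
    | some C =>
      if freeSet σ C = ∅ then 0
      else (freeSet σ C).card +
        univ.sup fun a : Fin n → Bool => if SatOn C (freeSet σ C) a then 0 else cdtF fuel F (σ.fix (freeSet σ C) a)

/-- The canonical decision tree depth of `F|σ`. [cite: Beame1994, §3] -/
def cdt (F : CNF (Fin n)) (σ : PAssign n) : ℕ := cdtF n F σ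

/-! ### Paths of the canonical decision tree -/

/-- A stage of a canonical path: the term examined, the variables queried (in the order of the
term) and the answers. [cite: Hastad2014, §3] -/
structure Stage (n : ℕ) where
  /-- the term examined at this stage -/
  term : Clause (Fin n)
  /-- the variables queried at this stage, in the order of the term -/
  vars : List (Fin n)
  /-- the answers (junk off `vars`) -/
  ans : Fin n → Bool

/-- The state after a stage. [cite: Hastad2014, §3] -/
def Stage.next (σ : PAssign n) (st : Stage n) : PAssign n := σ.fix st.vars.toFinset st.ans

/-- A *full* canonical path of `F` from `σ`: each stage examines the first live term, queries all
its free variables (at least one), and the path continues from the extended assignment. (Whether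
the answers falsify the term is not recorded: it is not needed for the encoding.) [cite: Hastad2014, §3] -/
def PathValid (F : CNF (Fin n)) : PAssign n → List (Stage n) → Prop
  | _, [] => True
  | σ, st :: rest => firstLive F σ = some st.term ∧ st.vars = freeVars σ st.term ∧ st.vars ≠ [] ∧
      PathValid F (st.next σ) rest

/-- The number of variables queried along a path. [folklore] -/
def pathLen : List (Stage n) → ℕ
  | [] => 0
  | st :: rest => st.vars.length + pathLen rest

/-- The empty path queries no variable. [folklore] -/
@[simp] theorem pathLen_nil : pathLen ([] : List (Stage n)) = 0 := rfl
/-- Length of a path, cons case. [folklore] -/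
@[simp] theorem pathLen_cons (st : Stage n) (rest : List (Stage n)) :
    pathLen (st :: rest) = st.vars.length + pathLen rest := rfl

/-- The free set is empty iff the list of free variables is. [folklore] -/
theorem freeSet_eq_empty_iff {σ : PAssign n} {C : Clause (Fin n)} : freeSet σ C = ∅ ↔ freeVars σ C = [] := by
  simp [freeSet, List.toFinset_eq_empty_iff]

/-- **Long paths exist**: if the canonical decision tree of `F|σ` has depth `> ℓ`, there is a full
canonical path from `σ` querying more than `ℓ` variables. [cite: Hastad2014, §3] -/
theorem exists_path_of_lt_cdtF : ∀ (fuel : ℕ) (F : CNF (Fin n)) (σ : PAssign n) (ℓ : ℕ),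
    ℓ < cdtF fuel F σ → ∃ P : List (Stage n), PathValid F σ P ∧ ℓ < pathLen P
  | 0, F, σ, ℓ, h => by simp [cdtF] at h
  | fuel + 1, F, σ, ℓ, h => by
    unfold cdtF at h
    cases hC : firstLive F σ with
    | none => rw [hC] at h; simp at h
    | some C =>
      rw [hC] at h
      simp only at h
      split_ifs at h with hS
      · simp at h
      have hne : freeVars σ C ≠ [] := fun h' => hS (freeSet_eq_empty_iff.2 h')
      by_cases hlen : ℓ < (freeSet σ C).card
      · refine ⟨[⟨C, freeVars σ C, fun _ => false⟩], ⟨hC, rfl, hne, trivial⟩, ?_⟩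
        simp only [pathLen_cons, pathLen_nil, add_zero]
        exact lt_of_lt_of_le hlen (List.toFinset_card_le _)
      · push Not at hlen
        -- some branch is deep
        have hsup : ℓ - (freeSet σ C).card <
            univ.sup (fun a : Fin n → Bool =>
              if SatOn C (freeSet σ C) a then 0 else cdtF fuel F (σ.fix (freeSet σ C) a)) := by
          omega
        rw [Finset.lt_sup_iff] at hsup
        obtain ⟨a, _, ha⟩ := hsup
        split_ifs at ha with hsat
        · simp at ha
        obtain ⟨P, hP, hlenP⟩ := exists_path_of_lt_cdtF fuel F (σ.fix (freeSet σ C) a) _ ha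
        refine ⟨⟨C, freeVars σ C, a⟩ :: P, ⟨hC, rfl, hne, ?_⟩, ?_⟩
        · simpa [Stage.next, freeSet] using hP
        · simp only [pathLen_cons]
          have : (freeSet σ C).card ≤ (freeVars σ C).length := List.toFinset_card_le _
          omega


/-! ### The variables of a path -/

/-- The variables queried along a path, in order. [folklore] -/
def pathVars : List (Stage n) → List (Fin n)
  | [] => []
  | st :: rest => st.vars ++ pathVars rest

/-- Variables of the empty path. [folklore] -/
@[simp] theorem pathVars_nil : pathVars ([] : List (Stage n)) = [] := rfl
/-- Variables of a path, cons case. [folklore] -/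
@[simp] theorem pathVars_cons (st : Stage n) (rest : List (Stage n)) :
    pathVars (st :: rest) = st.vars ++ pathVars rest := rfl

/-- A path queries `pathLen` variables. [folklore] -/
theorem length_pathVars : ∀ P : List (Stage n), (pathVars P).length = pathLen P
  | [] => rfl
  | st :: rest => by simp [length_pathVars rest]

/-- The set of variables queried along a path. [folklore] -/
def pathVarSet (P : List (Stage n)) : Finset (Fin n) := (pathVars P).toFinset

/-- The domain after a stage. [folklore] -/
theorem Stage.next_dom (σ : PAssign n) (st : Stage n) : (st.next σ).dom = σ.dom ∪ st.vars.toFinset := rfl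

/-- The free set after a stage. [folklore] -/
theorem Stage.next_free (σ : PAssign n) (st : Stage n) : (st.next σ).free = σ.free \ st.vars.toFinset :=
  free_fix _ _ _

/-- Along a full canonical path of a DNF with repetition-free terms, the queried variables are
pairwise distinct and free. [cite: Beame1994, §3] -/
theorem PathValid.nodup_free {Fi : CNF (Fin n)} (hF : ∀ C ∈ Fi, VarNodup C) :
    ∀ {σ : PAssign n} {P : List (Stage n)}, PathValid Fi σ P →
      (pathVars P).Nodup ∧ ∀ v ∈ pathVars P, v ∈ σ.free
  | σ, [], _ => by simp
  | σ, st :: rest, ⟨hC, hvars, _, hrest⟩ => by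
    have ih := PathValid.nodup_free hF hrest
    have hst : st.vars.Nodup := by rw [hvars]; exact (hF _ (mem_of_firstLive hC)).freeVars_nodup σ
    have hstfree : ∀ v ∈ st.vars, v ∈ σ.free := by
      intro v hv; rw [hvars] at hv
      exact freeVars_subset_free σ st.term (List.mem_toFinset.2 hv)
    refine ⟨List.nodup_append.2 ⟨hst, ih.1, ?_⟩, ?_⟩
    · rintro v hv _ hv' rfl
      have := ih.2 v hv'
      rw [Stage.next_free, Finset.mem_sdiff] at this
      exact this.2 (List.mem_toFinset.2 hv)
    · intro v hv
      rcases List.mem_append.1 hv with h | h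
      · exact hstfree v h
      · have := ih.2 v h
        rw [Stage.next_free, Finset.mem_sdiff] at this
        exact this.1

/-! ### Set-query processes (common partial decision trees querying blocks of variables) -/

/-- The depth of the adaptive process that at state `σ` queries the block of variables `Q σ`
(all assignments to the block are explored) and stops when `Q σ = ∅`; `fuel` bounds the number of
rounds. With `Q` the long-path query of a family of DNFs this is the depth of Håstad's canonical
common partial decision tree. [cite: Hastad2014, §3] -/
def procDepth (Q : PAssign n → Finset (Fin n)) : ℕ → PAssign n → ℕ
  | 0, _ => 0
  | fuel + 1, σ =>
    if Q σ = ∅ then 0 else (Q σ).card + univ.sup fun b : Fin n → Bool => procDepth Q fuel (σ.fix (Q σ) b)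

/-- The leaves (terminal states) of the process. [cite: Hastad2014, §3] -/
def procLeaves (Q : PAssign n → Finset (Fin n)) : ℕ → PAssign n → Finset (PAssign n)
  | 0, σ => {σ}
  | fuel + 1, σ =>
    if Q σ = ∅ then {σ} else univ.biUnion fun b : Fin n → Bool => procLeaves Q fuel (σ.fix (Q σ) b)

/-- With enough fuel (at least the number of free variables), every leaf is terminal, provided the
process only queries free variables and queries at least one. [folklore] -/
theorem procLeaves_terminal {Q : PAssign n → Finset (Fin n)} (hQ : ∀ σ, Q σ ⊆ σ.free) :
    ∀ (fuel : ℕ) (σ : PAssign n), σ.free.card ≤ fuel → ∀ τ ∈ procLeaves Q fuel σ, Q τ = ∅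
  | 0, σ, hσ, τ, hτ => by
    simp only [procLeaves, Finset.mem_singleton] at hτ
    subst hτ
    have : τ.free = ∅ := Finset.card_eq_zero.1 (Nat.le_zero.1 hσ)
    exact Finset.subset_empty.1 (this ▸ hQ τ)
  | fuel + 1, σ, hσ, τ, hτ => by
    simp only [procLeaves] at hτ
    split_ifs at hτ with h
    · simp only [Finset.mem_singleton] at hτ; subst hτ; exact h
    · simp only [Finset.mem_biUnion, Finset.mem_univ, true_and] at hτ
      obtain ⟨b, hb⟩ := hτ
      refine procLeaves_terminal hQ fuel _ ?_ τ hb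
      have hlt := card_free_fix_lt (hQ σ) (Finset.nonempty_iff_ne_empty.2 h) b
      omega

/-! ### Håstad's canonical common partial decision tree of a family of DNFs -/

section Common

variable {m : ℕ} (ℓ : ℕ) (F : Fin m → CNF (Fin n))

/-- A canonical long path: for `F|σ` of canonical depth `> ℓ`, a full canonical path from `σ`
querying more than `ℓ` variables (`[]` otherwise). [cite: Hastad2014, §3] -/
def longPath (Fi : CNF (Fin n)) (σ : PAssign n) : List (Stage n) :=
  if h : ℓ < cdt Fi σ then Classical.choose (exists_path_of_lt_cdtF n Fi σ ℓ h) else []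

/-- The canonical long path is a full canonical path querying more than `ℓ` variables. [cite: Hastad2014, §3] -/
theorem longPath_spec {Fi : CNF (Fin n)} {σ : PAssign n} (h : ℓ < cdt Fi σ) :
    PathValid Fi σ (longPath ℓ Fi σ) ∧ ℓ < pathLen (longPath ℓ Fi σ) := by
  unfold longPath; rw [dif_pos h]
  exact Classical.choose_spec (exists_path_of_lt_cdtF n Fi σ ℓ h)

/-- The block queried by the common tree at `σ`: the variables of a canonical long path of some
formula of the family whose canonical decision tree under `σ` is deeper than `ℓ` (none: stop).
[cite: Hastad2014, §3] -/
def swQuery (σ : PAssign n) : Finset (Fin n) :=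
  if h : ∃ i, ℓ < cdt (F i) σ then pathVarSet (longPath ℓ (F (Classical.choose h)) σ) else ∅

/-- The depth of the canonical common `ℓ`-partial decision tree of the family `(F i)|σ`.
[cite: Hastad2014, §3] -/
def ccDepth (fuel : ℕ) (σ : PAssign n) : ℕ := procDepth (swQuery ℓ F) fuel σ

/-- The common tree queries free variables. [cite: Hastad2014, §3] -/
theorem swQuery_subset_free (hF : ∀ i, ∀ C ∈ F i, VarNodup C) (σ : PAssign n) :
    swQuery ℓ F σ ⊆ σ.free := by
  unfold swQuery
  split_ifs with h
  · intro v hv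
    have hP := (longPath_spec ℓ (Classical.choose_spec h)).1
    exact (PathValid.nodup_free (hF _) hP).2 v (List.mem_toFinset.1 hv)
  · simp

/-- At a terminal state every formula of the family has canonical depth `≤ ℓ`. [cite: Hastad2014, §3] -/
theorem cdt_le_of_swQuery_eq_empty (hF : ∀ i, ∀ C ∈ F i, VarNodup C) {σ : PAssign n}
    (h : swQuery ℓ F σ = ∅) (i : Fin m) : cdt (F i) σ ≤ ℓ := by
  by_contra hlt
  push Not at hlt
  have hex : ∃ i, ℓ < cdt (F i) σ := ⟨i, hlt⟩
  unfold swQuery at h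
  rw [dif_pos hex] at h
  have hP := longPath_spec ℓ (Classical.choose_spec hex)
  have hnd := PathValid.nodup_free (hF _) hP.1
  have : (pathVarSet (longPath ℓ (F (Classical.choose hex)) σ)).card =
      pathLen (longPath ℓ (F (Classical.choose hex)) σ) := by
    rw [pathVarSet, List.toFinset_card_of_nodup hnd.1, length_pathVars]
  rw [h, Finset.card_empty] at this
  omega

/-! ### Witnesses of deep common trees -/

/-- A segment of a branch of the common tree: the formula it comes from, the canonical path of
that formula whose variables the common tree queries, and the branch's answers. [cite: Hastad2014, §3] -/
structure Segment (n m : ℕ) where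
  /-- the index of the formula contributing the segment -/
  idx : Fin m
  /-- the canonical long path of that formula -/
  path : List (Stage n)
  /-- the answers of the branch of the common tree on the variables of the segment -/
  vals : Fin n → Bool

/-- The state after a segment. [cite: Hastad2014, §3] -/
def Segment.next (σ : PAssign n) (seg : Segment n m) : PAssign n :=
  σ.fix (pathVarSet seg.path) seg.vals

/-- Validity of the *last* path of a witness: all stages are full except the last, which queries a
nonempty prefix of the free variables of its term (truncation to the exact depth). [cite: Hastad2014, §3] -/
def PathValidLast (Fi : CNF (Fin n)) : PAssign n → List (Stage n) → Prop
  | _, [] => False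
  | σ, [st] => firstLive Fi σ = some st.term ∧ st.vars <+: freeVars σ st.term ∧ st.vars ≠ []
  | σ, st :: st' :: rest => firstLive Fi σ = some st.term ∧ st.vars = freeVars σ st.term ∧ st.vars ≠ [] ∧
      PathValidLast Fi (st.next σ) (st' :: rest)

/-- Validity of a witness (a branch of the common tree cut at a prescribed depth): every segment
but the last is a full canonical long path (more than `ℓ` variables) of its formula from the
current state, the branch continuing with its own answers; the last segment is a truncated path. [cite: Hastad2014, §3] -/
def WitValid : PAssign n → List (Segment n m) → Prop
  | _, [] => False
  | σ, [seg] => PathValidLast (F seg.idx) σ seg.path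
  | σ, seg :: seg' :: rest => PathValid (F seg.idx) σ seg.path ∧ ℓ < pathLen seg.path ∧
      WitValid (seg.next σ) (seg' :: rest)

/-- The variables of a witness, in order. [folklore] -/
def witVars : List (Segment n m) → List (Fin n)
  | [] => []
  | seg :: rest => pathVars seg.path ++ witVars rest

/-- Variables of the empty witness. [folklore] -/
@[simp] theorem witVars_nil : witVars ([] : List (Segment n m)) = [] := rfl
/-- Variables of a witness, cons case. [folklore] -/
@[simp] theorem witVars_cons (seg : Segment n m) (rest : List (Segment n m)) :
    witVars (seg :: rest) = pathVars seg.path ++ witVars rest := rfl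

/-- The number of variables of a witness. [folklore] -/
def witLen (w : List (Segment n m)) : ℕ := (witVars w).length

/-- Truncation of a path to its first `b` variables. [cite: Hastad2014, §3] -/
def truncPath : List (Stage n) → ℕ → List (Stage n)
  | [], _ => []
  | st :: rest, b =>
    if b ≤ st.vars.length then [{ st with vars := st.vars.take b }]
    else st :: truncPath rest (b - st.vars.length)

/-- **Truncation**: cutting a full canonical path at `1 ≤ b ≤` its length gives a valid last path with exactly `b` variables. [cite: Hastad2014, §3] -/
theorem truncPath_valid {Fi : CNF (Fin n)} :
    ∀ {σ : PAssign n} {P : List (Stage n)} {b : ℕ}, PathValid Fi σ P → 1 ≤ b → b ≤ pathLen P →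
      PathValidLast Fi σ (truncPath P b) ∧ pathLen (truncPath P b) = b
  | σ, [], b, _, h1, hb => by simp at hb; omega
  | σ, st :: rest, b, ⟨hC, hvars, hne, hrest⟩, h1, hb => by
    unfold truncPath
    split_ifs with hle
    · refine ⟨⟨hC, ?_, ?_⟩, ?_⟩
      · simp only; rw [hvars]; exact List.take_prefix _ _
      · simp only
        intro h
        have := congrArg List.length h
        rw [List.length_take, List.length_nil] at this
        have : 0 < st.vars.length := List.length_pos_iff.2 hne
        omega
      · simp [List.length_take, Nat.min_eq_left hle]
    · push Not at hle
      have hb' : b - st.vars.length ≤ pathLen rest := by simp at hb; omega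
      have ih := truncPath_valid hrest (by omega) hb'
      have hne' : truncPath rest (b - st.vars.length) ≠ [] := by
        intro h; have := ih.1; rw [h] at this; exact this
      obtain ⟨st', rest', hrw⟩ := List.exists_cons_of_ne_nil hne'
      refine ⟨?_, ?_⟩
      · rw [hrw]
        refine ⟨hC, hvars, hne, ?_⟩
        rw [← hrw]; exact ih.1
      · simp only [pathLen_cons, ih.2]; omega

/-- A valid last path is nonempty. [folklore] -/
theorem PathValidLast.ne_nil {Fi : CNF (Fin n)} {σ : PAssign n} {P : List (Stage n)}
    (h : PathValidLast Fi σ P) : P ≠ [] := by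
  rintro rfl; exact h

/-- A valid witness is nonempty. [folklore] -/
theorem WitValid.ne_nil {σ : PAssign n} {w : List (Segment n m)} (h : WitValid ℓ F σ w) : w ≠ [] := by
  rintro rfl; exact h

/-- **Deep common trees have witnesses**: if the canonical common tree from `σ` has depth `≥ b ≥ 1`,
there is a valid witness from `σ` with exactly `b` variables and at most `(b-1)/(ℓ+1) + 1`
segments. [cite: Hastad2014, §3] -/
theorem exists_witness : ∀ (fuel : ℕ) (σ : PAssign n) (b : ℕ), 1 ≤ b → b ≤ ccDepth ℓ F fuel σ →
    ∃ w : List (Segment n m), WitValid ℓ F σ w ∧ witLen w = b ∧ w.length ≤ (b - 1) / (ℓ + 1) + 1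
  | 0, σ, b, h1, hb => by simp [ccDepth, procDepth] at hb; omega
  | fuel + 1, σ, b, h1, hb => by
    unfold ccDepth procDepth at hb
    split_ifs at hb with hQ
    · omega
    have hex : ∃ i, ℓ < cdt (F i) σ := by
      by_contra hne; unfold swQuery at hQ; rw [dif_neg hne] at hQ; exact hQ rfl
    set i := Classical.choose hex with hi
    have hP := longPath_spec ℓ (Classical.choose_spec hex)
    rw [← hi] at hP
    set P := longPath ℓ (F i) σ with hPdef
    have hQeq : swQuery ℓ F σ = pathVarSet P := by
      unfold swQuery; rw [dif_pos hex]
    by_cases hbP : b ≤ pathLen P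
    · obtain ⟨hv, hlen⟩ := truncPath_valid hP.1 h1 hbP
      refine ⟨[⟨i, truncPath P b, fun _ => false⟩], hv, ?_, ?_⟩
      · simp [witLen, length_pathVars, hlen]
      · simp
    · push Not at hbP
      have hcard : (pathVarSet P).card ≤ pathLen P := by
        rw [pathVarSet, ← length_pathVars]; exact List.toFinset_card_le _
      rw [hQeq] at hb
      have hsup : b - pathLen P ≤
          univ.sup (fun bb : Fin n → Bool => procDepth (swQuery ℓ F) fuel (σ.fix (pathVarSet P) bb)) := by
        omega
      have hsup' : b - pathLen P - 1 <
          univ.sup (fun bb : Fin n → Bool => procDepth (swQuery ℓ F) fuel (σ.fix (pathVarSet P) bb)) := by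
        omega
      rw [Finset.lt_sup_iff] at hsup'
      obtain ⟨bb, _, hbb⟩ := hsup'
      obtain ⟨w', hw', hlen', hcnt'⟩ :=
        exists_witness fuel (σ.fix (pathVarSet P) bb) (b - pathLen P) (by omega) (by unfold ccDepth; omega)
      obtain ⟨seg', rest', hrw⟩ := List.exists_cons_of_ne_nil (WitValid.ne_nil ℓ F hw')
      refine ⟨⟨i, P, bb⟩ :: w', ?_, ?_, ?_⟩
      · rw [hrw]; refine ⟨hP.1, hP.2, ?_⟩; rw [← hrw]; exact hw'
      · simp only [witLen, witVars_cons, List.length_append, length_pathVars]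
        unfold witLen at hlen'; omega
      · simp only [List.length_cons]
        have h2 := hP.2
        -- (b - pathLen P - 1)/(ℓ+1) + 1 + 1 ≤ (b-1)/(ℓ+1) + 1
        have key : (b - pathLen P - 1) / (ℓ + 1) + 1 ≤ (b - 1) / (ℓ + 1) := by
          have e1 : b - pathLen P - 1 ≤ b - 1 - (ℓ + 1) := by omega
          calc (b - pathLen P - 1) / (ℓ + 1) + 1 ≤ (b - 1 - (ℓ + 1)) / (ℓ + 1) + 1 :=
                Nat.add_le_add_right (Nat.div_le_div_right e1) 1
            _ = (b - 1 - (ℓ + 1) + (ℓ + 1)) / (ℓ + 1) := (Nat.add_div_right _ (Nat.succ_pos ℓ)).symm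
            _ = (b - 1) / (ℓ + 1) := by congr 1; omega
        omega

/-- Along a valid witness the variables are pairwise distinct and free. [cite: Hastad2014, §3] -/
theorem PathValidLast.nodup_free {Fi : CNF (Fin n)} (hF : ∀ C ∈ Fi, VarNodup C) :
    ∀ {σ : PAssign n} {P : List (Stage n)}, PathValidLast Fi σ P →
      (pathVars P).Nodup ∧ ∀ v ∈ pathVars P, v ∈ σ.free
  | σ, [], h => absurd h id
  | σ, [st], ⟨hC, hpre, _⟩ => by
    simp only [pathVars_cons, pathVars_nil, List.append_nil]
    refine ⟨hpre.sublist.nodup ((hF _ (mem_of_firstLive hC)).freeVars_nodup σ), fun v hv => ?_⟩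
    exact freeVars_subset_free σ st.term (List.mem_toFinset.2 (hpre.subset hv))
  | σ, st :: st' :: rest, ⟨hC, hvars, _, hrest⟩ => by
    have ih := PathValidLast.nodup_free hF hrest
    have hst : st.vars.Nodup := by rw [hvars]; exact (hF _ (mem_of_firstLive hC)).freeVars_nodup σ
    have hstfree : ∀ v ∈ st.vars, v ∈ σ.free := by
      intro v hv; rw [hvars] at hv
      exact freeVars_subset_free σ st.term (List.mem_toFinset.2 hv)
    refine ⟨List.nodup_append.2 ⟨hst, ih.1, ?_⟩, ?_⟩
    · rintro v hv _ hv' rfl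
      have := ih.2 v hv'
      rw [Stage.next_free, Finset.mem_sdiff] at this
      exact this.2 (List.mem_toFinset.2 hv)
    · intro v hv
      rw [pathVars_cons] at hv
      rcases List.mem_append.1 hv with h | h
      · exact hstfree v h
      · have := ih.2 v h
        rw [Stage.next_free, Finset.mem_sdiff] at this
        exact this.1

/-- The free set after a segment. [folklore] -/
theorem Segment.next_free (σ : PAssign n) (seg : Segment n m) :
    (seg.next σ).free = σ.free \ pathVarSet seg.path := free_fix _ _ _

/-- Along a valid witness the variables are pairwise distinct and free. [cite: Hastad2014, §3] -/
theorem WitValid.nodup_free (hF : ∀ i, ∀ C ∈ F i, VarNodup C) :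
    ∀ {σ : PAssign n} {w : List (Segment n m)}, WitValid ℓ F σ w →
      (witVars w).Nodup ∧ ∀ v ∈ witVars w, v ∈ σ.free
  | σ, [], h => absurd h id
  | σ, [seg], h => by
    have := PathValidLast.nodup_free (hF seg.idx) h
    simpa [witVars] using this
  | σ, seg :: seg' :: rest, ⟨hP, _, hrest⟩ => by
    have ih := WitValid.nodup_free hF hrest
    have h1 := PathValid.nodup_free (hF seg.idx) hP
    refine ⟨List.nodup_append.2 ⟨h1.1, ih.1, ?_⟩, ?_⟩
    · rintro v hv _ hv' rfl
      have := ih.2 v hv'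
      rw [Segment.next_free, Finset.mem_sdiff] at this
      exact this.2 (List.mem_toFinset.2 hv)
    · intro v hv
      rcases List.mem_append.1 hv with h | h
      · exact h1.2 v h
      · have := ih.2 v h
        rw [Segment.next_free, Finset.mem_sdiff] at this
        exact this.1

/-- The set of variables of a witness has exactly `witLen` elements and is disjoint from the domain. [cite: Hastad2014, §3] -/
theorem WitValid.card_witVars (hF : ∀ i, ∀ C ∈ F i, VarNodup C) {σ : PAssign n} {w : List (Segment n m)}
    (h : WitValid ℓ F σ w) : (witVars w).toFinset.card = witLen w ∧ Disjoint (witVars w).toFinset σ.dom := by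
  have := WitValid.nodup_free ℓ F hF h
  refine ⟨List.toFinset_card_of_nodup this.1, Finset.disjoint_left.2 fun v hv => ?_⟩
  exact mem_free.1 (this.2 v (List.mem_toFinset.1 hv))

end Common


/-! ### Razborov-style encoding of witnesses and its decoding -/

section Coding

variable {m : ℕ} (ℓ : ℕ) (F : Fin m → CNF (Fin n)) (t : ℕ)

/-- The values fixed by the encoding on the variables of a path: each queried variable gets the
value making its literal in the examined term true (Razborov's `ρσ₁…σ_k`). [cite: Beame1994, §3] -/
def starValP : List (Stage n) → (Fin n → Bool) → Fin n → Bool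
  | [], g => g
  | st :: rest, g => fun i => if i ∈ st.vars then polarity st.term i else starValP rest g i

/-- The values fixed by the encoding on the variables of a witness. [cite: Hastad2014, §3] -/
def starVal : List (Segment n m) → Fin n → Bool
  | [] => fun _ => false
  | seg :: rest => starValP seg.path (starVal rest)

/-- Off the variables of the path `starValP` is the default. [folklore] -/
theorem starValP_of_not_mem {g : Fin n → Bool} {v : Fin n} :
    ∀ {P : List (Stage n)}, v ∉ pathVars P → starValP P g v = g v
  | [], _ => rfl
  | st :: rest, hv => by
    simp only [pathVars_cons, List.mem_append, not_or] at hv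
    simp only [starValP, if_neg hv.1]
    exact starValP_of_not_mem hv.2

/-- Variables of a stage are variables of the path. [folklore] -/
theorem mem_pathVars_of_mem {P : List (Stage n)} {st : Stage n} (hst : st ∈ P) {v : Fin n} (hv : v ∈ st.vars) :
    v ∈ pathVars P := by
  induction P with
  | nil => simp at hst
  | cons a r ih =>
    simp only [pathVars_cons, List.mem_append]
    rcases List.mem_cons.1 hst with rfl | h
    · exact Or.inl hv
    · exact Or.inr (ih h)

/-- On a variable of a stage `starValP` is the polarity of its literal in the term of the stage. [cite: Beame1994, §3] -/
theorem starValP_of_mem {g : Fin n → Bool} {v : Fin n} :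
    ∀ {P : List (Stage n)}, (pathVars P).Nodup → ∀ st ∈ P, v ∈ st.vars → starValP P g v = polarity st.term v
  | [], _, st, hst, _ => absurd hst (by simp)
  | st' :: rest, hnd, st, hst, hv => by
    rw [pathVars_cons] at hnd
    have hdisj := List.disjoint_of_nodup_append hnd
    rcases List.mem_cons.1 hst with rfl | hst
    · simp [starValP, hv]
    · have hv' : v ∈ pathVars rest := mem_pathVars_of_mem hst hv
      have hnot : v ∉ st'.vars := fun h => hdisj h hv'
      simp only [starValP, if_neg hnot]
      exact starValP_of_mem (List.nodup_append.1 hnd).2.1 st hst hv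

/-- Variables of a segment are variables of the witness. [folklore] -/
theorem mem_witVars_of_mem {w : List (Segment n m)} {seg : Segment n m} (hseg : seg ∈ w) {v : Fin n}
    (hv : v ∈ pathVars seg.path) : v ∈ witVars w := by
  induction w with
  | nil => simp at hseg
  | cons a r ih =>
    simp only [witVars_cons, List.mem_append]
    rcases List.mem_cons.1 hseg with rfl | h
    · exact Or.inl hv
    · exact Or.inr (ih h)

/-- On the variables of a witness with pairwise distinct variables, `starVal` gives each variable
the value making its literal true in the term of its stage. [cite: Beame1994, §3] -/
theorem starVal_spec : ∀ {w : List (Segment n m)}, (witVars w).Nodup →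
    ∀ seg ∈ w, ∀ st ∈ seg.path, ∀ v ∈ st.vars, starVal w v = polarity st.term v
  | [], _, seg, hseg, _, _, _, _ => absurd hseg (by simp)
  | seg' :: rest, hnd, seg, hseg, st, hst, v, hv => by
    rw [witVars_cons] at hnd
    have hdisj := List.disjoint_of_nodup_append hnd
    have hnd' := List.nodup_append.1 hnd
    rcases List.mem_cons.1 hseg with rfl | hseg
    · exact starValP_of_mem hnd'.1 st hst hv
    · have hv' : v ∈ witVars rest := mem_witVars_of_mem hseg (mem_pathVars_of_mem hst hv)
      have hnot : v ∉ pathVars seg'.path := fun h => hdisj h hv'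
      simp only [starVal]
      rw [starValP_of_not_mem hnot]
      exact starVal_spec hnd'.2.1 seg hseg st hst v hv

/-- A code letter: the position of the queried variable in the examined term, the answer of the
canonical path, the answer of the branch of the common tree, and the original (junk) value of the
restriction at the variable. [cite: Hastad2014, §3] -/
structure Entry (t : ℕ) where
  /-- position of the variable in the term (`< t` for terms of width `≤ t`) -/
  pos : Fin (t + 1)
  /-- the answer recorded on the canonical path -/
  ans : Bool
  /-- the answer of the branch of the common tree -/
  val : Bool
  /-- the junk value of the original restriction at the (free) variable -/
  old : Bool
  deriving DecidableEq, Fintype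

/-- Encoding of a stage. [cite: Beame1994, §3] -/
def encStage (β J : Fin n → Bool) (st : Stage n) : List (Entry t) :=
  st.vars.map fun v => ⟨⟨min (posOf st.term v) t, by omega⟩, st.ans v, β v, J v⟩

/-- Encoding of a path. [cite: Beame1994, §3] -/
def encPath (β J : Fin n → Bool) (P : List (Stage n)) : List (List (Entry t)) := P.map (encStage t β J)

/-- Encoding of a witness: the formula index of each segment and the letters of its stages. [cite: Hastad2014, §3] -/
def encWit (J : Fin n → Bool) (w : List (Segment n m)) : List (Fin m × List (List (Entry t))) :=
  w.map fun seg => (seg.idx, encPath t seg.vals J seg.path)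

/-- The data of a path, as recovered by the decoder: variable, path answer, branch answer, junk. [folklore] -/
def pathQuads (β J : Fin n → Bool) : List (Stage n) → List (Fin n × Bool × Bool × Bool)
  | [] => []
  | st :: rest => (st.vars.map fun v => (v, st.ans v, β v, J v)) ++ pathQuads β J rest

/-- The first components of the data of a path are its variables. [folklore] -/
theorem map_fst_pathQuads (β J : Fin n → Bool) : ∀ P : List (Stage n), (pathQuads β J P).map Prod.fst = pathVars P
  | [] => rfl
  | st :: rest => by simp [pathQuads, map_fst_pathQuads β J rest, Function.comp_def]

/-- Decoding of a stage, given its term. [cite: Beame1994, §3] -/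
def decStage (C : Clause (Fin n)) (es : List (Entry t)) : List (Fin n × Bool × Bool × Bool) :=
  es.filterMap fun e => (C[e.pos.val]?).map fun l => (l.1, e.ans, e.val, e.old)

/-- Decoding of a path of `Fi` from the hybrid restriction `H`: the examined term is the first live
term of `H`; after a stage the recorded path answers replace the values of `H` on its variables. [cite: Beame1994, §3] -/
def decPath (Fi : CNF (Fin n)) : PAssign n → List (List (Entry t)) → List (Fin n × Bool × Bool × Bool)
  | _, [] => []
  | H, es :: rest =>
    match firstLive Fi H with
    | none => []
    | some C =>
      decStage t C es ++
        decPath Fi (H.setVals ((decStage t C es).map Prod.fst).toFinset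
          (polarity ((decStage t C es).map fun x => (x.1, x.2.1)))) rest

/-- Decoding of a witness code from the hybrid restriction `H = ρ*`: returns `ρ`. After a segment the
branch answers replace the values on its variables; at the end the junk values are restored and the
variables freed. [cite: Hastad2014, §3] -/
def decWit : PAssign n → List (Fin m × List (List (Entry t))) → PAssign n
  | H, [] => H
  | H, [(i, pc)] =>
    let q := decPath t (F i) H pc
    let V := (q.map Prod.fst).toFinset
    ⟨H.dom \ V, V.piecewise (polarity (q.map fun x => (x.1, x.2.2.2))) H.val⟩
  | H, (i, pc) :: r :: rs =>
    let q := decPath t (F i) H pc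
    let V := (q.map Prod.fst).toFinset
    let X := decWit (H.setVals V (polarity (q.map fun x => (x.1, x.2.2.1)))) (r :: rs)
    ⟨X.dom \ V, V.piecewise (polarity (q.map fun x => (x.1, x.2.2.2))) X.val⟩

/-! #### Correctness of the decoding -/

/-- `polarity` of a graph-list `[(v, g v)]` is `g` on the listed variables. [folklore] -/
theorem polarity_map_self {vs : List (Fin n)} (g : Fin n → Bool) {v : Fin n} (hv : v ∈ vs) :
    polarity (vs.map fun v => (v, g v)) v = g v := by
  unfold polarity
  rw [List.find?_map]
  cases hf : vs.find? ((fun l : Fin n × Bool => decide (l.1 = v)) ∘ fun v => (v, g v)) with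
  | none =>
    exfalso
    rw [List.find?_eq_none] at hf
    exact absurd (by simp) (hf v hv)
  | some v' =>
    have := List.find?_some hf
    simp only [Function.comp_apply, decide_eq_true_eq] at this
    simp [this]

/-- **Decoding a stage**: the letters of a stage, read against its term, give back its variables and answers. [cite: Beame1994, §3] -/
theorem decStage_encStage {C : Clause (Fin n)} (hC : C.length ≤ t) (ans β J : Fin n → Bool) :
    ∀ {vs : List (Fin n)}, (∀ v ∈ vs, ∃ b, (v, b) ∈ C) →
      decStage t C (vs.map fun v => (⟨⟨min (posOf C v) t, by omega⟩, ans v, β v, J v⟩ : Entry t)) =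
        vs.map fun v => (v, ans v, β v, J v)
  | [], _ => rfl
  | v :: vs, h => by
    obtain ⟨hlt, hv⟩ := getElem_posOf (h v (by simp))
    have hmin : min (posOf C v) t = posOf C v := Nat.min_eq_left (by omega)
    simp only [List.map_cons, decStage, List.filterMap_cons]
    rw [show C[min (posOf C v) t]? = some C[posOf C v] by rw [hmin]; exact List.getElem?_eq_getElem hlt]
    simp only [Option.map_some, hv]
    congr 1
    exact decStage_encStage hC ans β J (fun w hw => h w (by simp [hw]))

/-- `setVals` only depends on the values on the block. [folklore] -/
theorem setVals_congr (σ : PAssign n) (S : Finset (Fin n)) {a a' : Fin n → Bool} (h : ∀ i ∈ S, a i = a' i) :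
    σ.setVals S a = σ.setVals S a' := by
  ext i
  · rfl
  · simp only [setVals_val]; split_ifs with hi
    · exact h i hi
    · rfl

/-- The first live term of the hybrid restriction is the term of the stage. [cite: Beame1994, §3] -/
theorem firstLive_hybrid {Fi : CNF (Fin n)} (hF : ∀ C ∈ Fi, VarNodup C) {σ : PAssign n} {st : Stage n}
    {W : Finset (Fin n)} {sv : Fin n → Bool} (hC : firstLive Fi σ = some st.term)
    (hcov : ∀ l ∈ st.term, l.1 ∈ W → l.1 ∉ σ.dom → l.1 ∈ st.vars)
    (hsv : ∀ v ∈ st.vars, sv v = polarity st.term v) (hW : Disjoint W σ.dom) :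
    firstLive Fi (σ.fix W sv) = some st.term := by
  have hWfree : W ⊆ σ.free := fun v hv => mem_free.2 (Finset.disjoint_left.1 hW hv)
  refine firstLive_transfer hC (fun T hT => hT.fix hWfree sv) ?_
  rintro ⟨l, hl, hdom, hval⟩
  rw [fix_val] at hval
  have hnot := (firstLive_eq_some_iff.1 hC).1
  by_cases hlW : l.1 ∈ W
  · rw [if_pos hlW] at hval
    have hld : l.1 ∉ σ.dom := Finset.disjoint_left.1 hW hlW
    have := hsv l.1 (hcov l hl hlW hld)
    rw [this, (hF _ (mem_of_firstLive hC)).polarity_eq hl] at hval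
    exact hval rfl
  · rw [if_neg hlW] at hval
    rw [fix_dom, Finset.mem_union] at hdom
    rcases hdom with hd | hd
    · exact hnot ⟨l, hl, hd, hval⟩
    · exact hlW hd

/-- **Decoding a full path** from a hybrid restriction `σ ⊕_W sv` (`W` containing the variables of
the path and `sv` correct on them) recovers its data. [cite: Beame1994, §3] -/
theorem decPath_encPath {Fi : CNF (Fin n)} (hF : ∀ C ∈ Fi, VarNodup C) (ht : ∀ C ∈ Fi, C.length ≤ t)
    (β J sv : Fin n → Bool) :
    ∀ {σ : PAssign n} {P : List (Stage n)} {W : Finset (Fin n)}, PathValid Fi σ P →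
      (∀ st ∈ P, ∀ v ∈ st.vars, sv v = polarity st.term v) → pathVarSet P ⊆ W → Disjoint W σ.dom →
      decPath t Fi (σ.fix W sv) (encPath t β J P) = pathQuads β J P
  | σ, [], W, _, _, _, _ => by simp [encPath, decPath, pathQuads]
  | σ, st :: rest, W, hv, hsv, hPW, hW => by
    have hnd := PathValid.nodup_free hF hv
    obtain ⟨hC, hvars, hne, hrest⟩ := hv
    have hmemC := mem_of_firstLive hC
    have hfl : firstLive Fi (σ.fix W sv) = some st.term :=
      firstLive_hybrid hF hC (fun l hl _ hld => by rw [hvars]; exact mem_freeVars.2 ⟨l.2, hl, hld⟩)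
        (hsv st (by simp)) hW
    have hstage : decStage t st.term (encStage t β J st) = st.vars.map fun v => (v, st.ans v, β v, J v) := by
      unfold encStage
      refine decStage_encStage t (ht _ hmemC) st.ans β J fun v hvv => ?_
      rw [hvars] at hvv
      obtain ⟨b, hb, _⟩ := mem_freeVars.1 hvv
      exact ⟨b, hb⟩
    simp only [encPath, List.map_cons, decPath, hfl, pathQuads]
    rw [← encPath, hstage]
    congr 1
    have hS : ((st.vars.map fun v => (v, st.ans v, β v, J v)).map Prod.fst).toFinset = st.vars.toFinset := by
      rw [List.map_map]; simp [Function.comp_def]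
    have ha : ∀ i ∈ st.vars.toFinset,
        polarity ((st.vars.map fun v => (v, st.ans v, β v, J v)).map fun x => (x.1, x.2.1)) i = st.ans i := by
      intro i hi
      rw [List.map_map]
      exact polarity_map_self st.ans (List.mem_toFinset.1 hi)
    rw [hS, setVals_congr _ _ ha]
    have hSW : st.vars.toFinset ⊆ W := fun v hvv => hPW (by
      rw [pathVarSet, List.mem_toFinset, pathVars_cons]; exact List.mem_append_left _ (List.mem_toFinset.1 hvv))
    rw [setVals_fix hSW]
    refine decPath_encPath hF ht β J sv hrest (fun s hs => hsv s (by simp [hs])) ?_ ?_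
    · intro v hvv
      rw [pathVarSet, List.mem_toFinset] at hvv
      refine Finset.mem_sdiff.2 ⟨hPW ?_, fun hvS => ?_⟩
      · rw [pathVarSet, List.mem_toFinset, pathVars_cons]; exact List.mem_append_right _ hvv
      · exact List.disjoint_of_nodup_append (pathVars_cons st rest ▸ hnd.1) (List.mem_toFinset.1 hvS) hvv
    · rw [Finset.disjoint_left]
      intro v hvv
      simp only [Finset.mem_sdiff] at hvv
      change v ∉ σ.dom ∪ st.vars.toFinset
      rw [Finset.mem_union, not_or]
      exact ⟨Finset.disjoint_left.1 hW hvv.1, hvv.2⟩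

/-- **Decoding the last (truncated) path** from `σ ⊕_W sv` with `W` exactly its variables. [cite: Beame1994, §3] -/
theorem decPath_encPath_last {Fi : CNF (Fin n)} (hF : ∀ C ∈ Fi, VarNodup C) (ht : ∀ C ∈ Fi, C.length ≤ t)
    (β J sv : Fin n → Bool) :
    ∀ {σ : PAssign n} {P : List (Stage n)} {W : Finset (Fin n)}, PathValidLast Fi σ P →
      (∀ st ∈ P, ∀ v ∈ st.vars, sv v = polarity st.term v) → pathVarSet P = W → Disjoint W σ.dom →
      decPath t Fi (σ.fix W sv) (encPath t β J P) = pathQuads β J P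
  | σ, [], W, hv, _, _, _ => absurd hv id
  | σ, [st], W, ⟨hC, hpre, hne⟩, hsv, hPW, hW => by
    have hmemC := mem_of_firstLive hC
    have hWeq : W = st.vars.toFinset := by rw [← hPW]; simp [pathVarSet]
    have hfl : firstLive Fi (σ.fix W sv) = some st.term :=
      firstLive_hybrid hF hC (fun l _ hlW _ => by rw [hWeq] at hlW; exact List.mem_toFinset.1 hlW)
        (hsv st (by simp)) hW
    have hstage : decStage t st.term (encStage t β J st) = st.vars.map fun v => (v, st.ans v, β v, J v) := by
      unfold encStage
      refine decStage_encStage t (ht _ hmemC) st.ans β J fun v hvv => ?_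
      obtain ⟨b, hb, _⟩ := mem_freeVars.1 (hpre.subset hvv)
      exact ⟨b, hb⟩
    simp only [encPath, List.map_cons, List.map_nil, decPath, hfl, pathQuads, List.append_nil]
    exact hstage
  | σ, st :: st' :: rest, W, ⟨hC, hvars, hne, hrest⟩, hsv, hPW, hW => by
    have hnd := PathValidLast.nodup_free hF (P := st :: st' :: rest) ⟨hC, hvars, hne, hrest⟩
    have hmemC := mem_of_firstLive hC
    have hfl : firstLive Fi (σ.fix W sv) = some st.term :=
      firstLive_hybrid hF hC (fun l hl _ hld => by rw [hvars]; exact mem_freeVars.2 ⟨l.2, hl, hld⟩)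
        (hsv st (by simp)) hW
    have hstage : decStage t st.term (encStage t β J st) = st.vars.map fun v => (v, st.ans v, β v, J v) := by
      unfold encStage
      refine decStage_encStage t (ht _ hmemC) st.ans β J fun v hvv => ?_
      rw [hvars] at hvv
      obtain ⟨b, hb, _⟩ := mem_freeVars.1 hvv
      exact ⟨b, hb⟩
    have hPW' : pathVarSet (st :: st' :: rest) ⊆ W := hPW ▸ le_rfl
    have hsplit : encPath t β J (st :: st' :: rest) = encStage t β J st :: encPath t β J (st' :: rest) := rfl
    rw [hsplit]
    generalize hE : encPath t β J (st' :: rest) = E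
    simp only [decPath, hfl]
    subst hE
    rw [show pathQuads β J (st :: st' :: rest) =
        (st.vars.map fun v => (v, st.ans v, β v, J v)) ++ pathQuads β J (st' :: rest) from rfl, hstage]
    congr 1
    have hS : ((st.vars.map fun v => (v, st.ans v, β v, J v)).map Prod.fst).toFinset = st.vars.toFinset := by
      rw [List.map_map]; simp [Function.comp_def]
    have ha : ∀ i ∈ st.vars.toFinset,
        polarity ((st.vars.map fun v => (v, st.ans v, β v, J v)).map fun x => (x.1, x.2.1)) i = st.ans i := by
      intro i hi
      rw [List.map_map]
      exact polarity_map_self st.ans (List.mem_toFinset.1 hi)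
    rw [hS, setVals_congr _ _ ha]
    have hSW : st.vars.toFinset ⊆ W := fun v hvv => hPW' (by
      rw [pathVarSet, List.mem_toFinset, pathVars_cons]; exact List.mem_append_left _ (List.mem_toFinset.1 hvv))
    rw [setVals_fix hSW]
    refine decPath_encPath_last hF ht β J sv (P := st' :: rest) (W := W \ st.vars.toFinset) hrest
      (fun s hs => hsv s (by simp [hs])) ?_ ?_
    · rw [← hPW]
      ext v
      simp only [pathVarSet, List.mem_toFinset, Finset.mem_sdiff, pathVars_cons (st := st), List.mem_append]
      constructor
      · intro hv
        refine ⟨Or.inr hv, fun hvS => ?_⟩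
        exact List.disjoint_of_nodup_append (pathVars_cons st (st' :: rest) ▸ hnd.1) hvS hv
      · rintro ⟨h | h, h2⟩
        · exact absurd h h2
        · exact h
    · rw [Finset.disjoint_left]
      intro v hvv
      simp only [Finset.mem_sdiff] at hvv
      change v ∉ σ.dom ∪ st.vars.toFinset
      rw [Finset.mem_union, not_or]
      exact ⟨Finset.disjoint_left.1 hW hvv.1, hvv.2⟩

/-- Restoring the junk values and freeing the variables of a block recovers the restriction. [folklore] -/
theorem restore_eq {σ : PAssign n} {V : Finset (Fin n)} (hV : Disjoint V σ.dom) {Jf : Fin n → Bool}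
    (hJ : ∀ i ∈ V, Jf i = σ.val i) (g : Fin n → Bool) :
    (⟨(σ.fix V g).dom \ V, V.piecewise Jf (σ.fix V g).val⟩ : PAssign n) = σ := by
  ext i
  · simp only [fix_dom, Finset.mem_sdiff, Finset.mem_union]
    constructor
    · rintro ⟨h | h, h2⟩
      · exact h
      · exact absurd h h2
    · intro h; exact ⟨Or.inl h, fun hv => Finset.disjoint_left.1 hV hv h⟩
  · simp only [Finset.piecewise, fix_val]
    split_ifs with hi
    · exact hJ i hi
    · rfl

/-- **Decoding recovers the restriction**: from `ρ* = σ ⊕_W sv` (`W` the variables of a valid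
witness, `sv` correct on them) and the code of the witness (junk letters `J = σ.val`), `decWit`
returns `σ`. [cite: Hastad2014, §3] -/
theorem decWit_encWit (hF : ∀ i, ∀ C ∈ F i, VarNodup C) (ht : ∀ i, ∀ C ∈ F i, C.length ≤ t)
    (J sv : Fin n → Bool) :
    ∀ {σ : PAssign n} {w : List (Segment n m)}, WitValid ℓ F σ w →
      (∀ seg ∈ w, ∀ st ∈ seg.path, ∀ v ∈ st.vars, sv v = polarity st.term v) →
      (∀ v ∈ witVars w, J v = σ.val v) →
      decWit F t (σ.fix (witVars w).toFinset sv) (encWit t J w) = σ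
  | σ, [], hv, _, _ => absurd hv id
  | σ, [seg], hv, hsv, hJ => by
    have hcard := WitValid.card_witVars ℓ F hF hv
    change PathValidLast (F seg.idx) σ seg.path at hv
    have hW : (witVars [seg]).toFinset = pathVarSet seg.path := by simp [witVars, pathVarSet]
    have hq := decPath_encPath_last t (hF seg.idx) (ht seg.idx) seg.vals J sv hv (hsv seg (by simp)) hW.symm
      (hW ▸ hcard.2)
    simp only [encWit, List.map_cons, List.map_nil, decWit]
    rw [hq, map_fst_pathQuads]
    have hV : Disjoint (pathVars seg.path).toFinset σ.dom := by
      have := hcard.2; simpa [witVars] using this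
    rw [hW]
    refine restore_eq hV (fun i hi => ?_) sv
    have hi' : i ∈ pathVars seg.path := List.mem_toFinset.1 hi
    have e1 : polarity ((pathQuads seg.vals J seg.path).map fun x => (x.1, x.2.2.2)) i = J i := by
      have : (pathQuads seg.vals J seg.path).map (fun x => (x.1, x.2.2.2)) =
          (pathVars seg.path).map fun v => (v, J v) := by
        clear hv hsv hJ hcard hW hq hV hi hi'
        induction seg.path with
        | nil => rfl
        | cons st rest ih => simp [pathQuads, ih, Function.comp_def]
      rw [this]; exact polarity_map_self J hi'
    rw [e1]; exact hJ i (by simpa [witVars] using hi')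
  | σ, seg :: seg' :: rest, hv, hsv, hJ => by
    have hcard := WitValid.card_witVars ℓ F hF hv
    have hnd := WitValid.nodup_free ℓ F hF hv
    obtain ⟨hP, hlen, hrest⟩ := hv
    set W := (witVars (seg :: seg' :: rest)).toFinset with hWdef
    have hVW : pathVarSet seg.path ⊆ W := by
      intro v hvv; rw [hWdef, List.mem_toFinset, witVars_cons]
      exact List.mem_append_left _ (List.mem_toFinset.1 hvv)
    have hq := decPath_encPath t (hF seg.idx) (ht seg.idx) seg.vals J sv hP (hsv seg (by simp)) hVW hcard.2
    simp only [encWit, List.map_cons, decWit]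
    rw [← encWit, hq, map_fst_pathQuads]
    -- the values set after the segment
    have hβ : ∀ i ∈ (pathVars seg.path).toFinset,
        polarity ((pathQuads seg.vals J seg.path).map fun x => (x.1, x.2.2.1)) i = seg.vals i := by
      intro i hi
      have : (pathQuads seg.vals J seg.path).map (fun x => (x.1, x.2.2.1)) =
          (pathVars seg.path).map fun v => (v, seg.vals v) := by
        clear hP hsv hJ hcard hq hVW hi hnd hlen hrest hWdef
        induction seg.path with
        | nil => rfl
        | cons st r ih => simp [pathQuads, ih, Function.comp_def]
      rw [this]; exact polarity_map_self seg.vals (List.mem_toFinset.1 hi)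
    rw [setVals_congr _ _ hβ]
    have hVW' : (pathVars seg.path).toFinset ⊆ W := hVW
    rw [setVals_fix hVW']
    -- W minus V = variables of the rest
    have hWV : W \ (pathVars seg.path).toFinset = (witVars (seg' :: rest)).toFinset := by
      rw [hWdef]
      ext v
      simp only [Finset.mem_sdiff, List.mem_toFinset, witVars_cons (seg := seg), List.mem_append]
      constructor
      · rintro ⟨h | h, h2⟩
        · exact absurd h h2
        · exact h
      · intro h
        refine ⟨Or.inr h, fun h2 => ?_⟩
        exact List.disjoint_of_nodup_append (witVars_cons seg (seg' :: rest) ▸ hnd.1) h2 h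
    rw [hWV]
    have hdisj := List.disjoint_of_nodup_append (witVars_cons seg (seg' :: rest) ▸ hnd.1)
    have ih := decWit_encWit hF ht J sv (σ := seg.next σ) (w := seg' :: rest) hrest
      (fun s hs => hsv s (by simp [hs])) (fun v hvv => by
        rw [hJ v (by rw [witVars_cons]; exact List.mem_append_right _ hvv)]
        change σ.val v = (σ.fix (pathVarSet seg.path) seg.vals).val v
        rw [fix_val, if_neg]
        intro hvV
        exact hdisj (List.mem_toFinset.1 hvV) hvv)
    rw [show encWit t J (seg' :: rest) = (seg'.idx, encPath t seg'.vals J seg'.path) :: encWit t J rest from rfl] at ih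
    rw [show σ.fix (pathVars seg.path).toFinset seg.vals = seg.next σ from rfl, ih]
    have hV : Disjoint (pathVars seg.path).toFinset σ.dom :=
      Finset.disjoint_left.2 fun v hvv => Finset.disjoint_left.1 hcard.2 (hVW hvv)
    show (⟨(σ.fix (pathVars seg.path).toFinset seg.vals).dom \ (pathVars seg.path).toFinset,
      (pathVars seg.path).toFinset.piecewise (polarity ((pathQuads seg.vals J seg.path).map fun x => (x.1, x.2.2.2)))
        (σ.fix (pathVars seg.path).toFinset seg.vals).val⟩ : PAssign n) = σ
    refine restore_eq hV (fun i hi => ?_) seg.vals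
    have hi' : i ∈ pathVars seg.path := List.mem_toFinset.1 hi
    have e1 : polarity ((pathQuads seg.vals J seg.path).map fun x => (x.1, x.2.2.2)) i = J i := by
      have : (pathQuads seg.vals J seg.path).map (fun x => (x.1, x.2.2.2)) =
          (pathVars seg.path).map fun v => (v, J v) := by
        clear hP hsv hJ hcard hq hVW hi hi' hnd hlen hrest hWdef hβ hVW' hWV ih hV
        induction seg.path with
        | nil => rfl
        | cons st r ih => simp [pathQuads, ih, Function.comp_def]
      rw [this]; exact polarity_map_self J hi'
    rw [e1]; exact hJ i (by rw [witVars_cons]; exact List.mem_append_left _ hi')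

end Coding


/-! ### Flattening nested lists (to count codes) -/

section Flat

variable {α : Type*}

/-- Mark the last element of a (nonempty) list. [folklore] -/
def markLast : List α → List (α × Bool)
  | [] => []
  | [a] => [(a, true)]
  | a :: b :: l => (a, false) :: markLast (b :: l)

/-- Flatten a list of lists, marking the last element of each block. [folklore] -/
def flatL : List (List α) → List (α × Bool)
  | [] => []
  | l :: L => markLast l ++ flatL L

/-- Inverse of `flatL` on lists of nonempty lists. [folklore] -/
def unflatL : List (α × Bool) → List (List α)
  | [] => []
  | (a, true) :: rest => [a] :: unflatL rest
  | (a, false) :: rest =>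
    match unflatL rest with
    | [] => [[a]]
    | g :: gs => (a :: g) :: gs

/-- `markLast` preserves the length. [folklore] -/
theorem length_markLast : ∀ l : List α, (markLast l).length = l.length
  | [] => rfl
  | [_] => rfl
  | a :: b :: l => by simp [markLast, length_markLast (b :: l)]

/-- The length of a flattened list is the total length. [folklore] -/
theorem length_flatL : ∀ L : List (List α), (flatL L).length = (L.map List.length).sum
  | [] => rfl
  | l :: L => by simp [flatL, length_markLast, length_flatL L]

/-- `markLast` of a nonempty list is nonempty. [folklore] -/
theorem markLast_ne_nil : ∀ {l : List α}, l ≠ [] → markLast l ≠ []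
  | [], h => absurd rfl h
  | [_], _ => by simp [markLast]
  | a :: b :: l, _ => by simp [markLast]

/-- The flattening of a nonempty list of nonempty lists is nonempty. [folklore] -/
theorem flatL_ne_nil {L : List (List α)} (hL : L ≠ []) (h : ∀ l ∈ L, l ≠ []) : flatL L ≠ [] := by
  obtain ⟨l, L', rfl⟩ := List.exists_cons_of_ne_nil hL
  simp only [flatL, ne_eq, List.append_eq_nil_iff, not_and]
  intro h1
  exact absurd h1 (markLast_ne_nil (h l (by simp)))

/-- `unflatL` reads back a marked block. [folklore] -/
theorem unflatL_markLast_append : ∀ {l : List α}, l ≠ [] → ∀ R : List (α × Bool),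
    unflatL (markLast l ++ R) = l :: unflatL R
  | [], h, _ => absurd rfl h
  | [a], _, R => by simp [markLast, unflatL]
  | a :: b :: l, _, R => by
    simp only [markLast, List.cons_append, unflatL]
    rw [unflatL_markLast_append (l := b :: l) (by simp) R]

/-- `unflatL` inverts `flatL` on lists of nonempty lists. [folklore] -/
theorem unflatL_flatL : ∀ {L : List (List α)}, (∀ l ∈ L, l ≠ []) → unflatL (flatL L) = L
  | [], _ => rfl
  | l :: L, h => by
    simp only [flatL]
    rw [unflatL_markLast_append (h l (by simp)), unflatL_flatL (fun l' hl' => h l' (by simp [hl']))]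

/-- Lists of length at most `R` are determined by their first `R` optional entries. [folklore] -/
theorem list_eq_of_getElem?_eq {R : ℕ} {l₁ l₂ : List α} (h₁ : l₁.length ≤ R) (h₂ : l₂.length ≤ R)
    (h : ∀ k < R, l₁[k]? = l₂[k]?) : l₁ = l₂ := by
  refine List.ext_getElem? fun k => ?_
  by_cases hk : k < R
  · exact h k hk
  · rw [List.getElem?_eq_none (by omega), List.getElem?_eq_none (by omega)]

end Flat

/-! ### The random restriction `R_p` on partial assignments -/

/-- The weight of `σ = (A, v)` under `R_p`: each variable is fixed (put in `A`) independently with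
probability `1 - p`, and the values `v` are uniform on all of `{0,1}^n` (the values off `A` are
junk, so the induced law of the restriction is Håstad's `R_p`). [cite: Hastad1986, §2] -/
def rrWeight (p : ℝ) (σ : PAssign n) : ℝ := (1 - p) ^ σ.dom.card * p ^ (n - σ.dom.card) / 2 ^ n

/-- Weights are nonnegative for `p ∈ [0,1]`. [folklore] -/
theorem rrWeight_nonneg {p : ℝ} (hp0 : 0 ≤ p) (hp1 : p ≤ 1) (σ : PAssign n) : 0 ≤ rrWeight p σ := by
  unfold rrWeight
  have : 0 ≤ 1 - p := by linarith
  positivity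

/-- `PAssign n` is the product `Finset (Fin n) × (Fin n → Bool)`. [folklore] -/
def PAssign.equivProd : PAssign n ≃ Finset (Fin n) × (Fin n → Bool) where
  toFun σ := (σ.dom, σ.val)
  invFun q := ⟨q.1, q.2⟩
  left_inv _ := rfl
  right_inv _ := rfl

/-- Sums over partial assignments are double sums over domains and value functions. [folklore] -/
theorem sum_PAssign (f : PAssign n → ℝ) : ∑ σ, f σ = ∑ A : Finset (Fin n), ∑ v : Fin n → Bool, f ⟨A, v⟩ := by
  rw [← Fintype.sum_prod_type']
  exact Fintype.sum_equiv PAssign.equivProd _ _ fun σ => rfl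

/-- `R_p` is a probability distribution. [cite: Hastad1986, §2] -/
theorem sum_rrWeight (p : ℝ) : ∑ σ : PAssign n, rrWeight p σ = 1 := by
  rw [sum_PAssign]
  have hA : ∀ A : Finset (Fin n), ∑ _v : Fin n → Bool, rrWeight p (⟨A, _v⟩ : PAssign n) =
      (1 - p) ^ A.card * p ^ (n - A.card) := by
    intro A
    simp only [rrWeight, Finset.sum_const, Finset.card_univ, Fintype.card_fun, Fintype.card_bool,
      Fintype.card_fin, nsmul_eq_mul, Nat.cast_pow, Nat.cast_ofNat]
    field_simp
  simp_rw [hA]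
  have h := Fintype.sum_pow_mul_eq_add_pow (Fin n) (1 - p) p
  rwa [Fintype.card_fin, sub_add_cancel, one_pow] at h

/-- **Weight transfer**: fixing `D` further (free) variables multiplies the weight by
`((1-p)/p)^D`: `(1-p)^D · w(σ) = p^D · w(σ ⊕_W sv)` for `|W| = D`, `W ∩ dom σ = ∅`. [cite: Beame1994, §3] -/
theorem rrWeight_fix (p : ℝ) (σ : PAssign n) {W : Finset (Fin n)} (hW : Disjoint W σ.dom) (sv : Fin n → Bool) :
    (1 - p) ^ W.card * rrWeight p σ = p ^ W.card * rrWeight p (σ.fix W sv) := by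
  unfold rrWeight
  have hcard : (σ.fix W sv).dom.card = σ.dom.card + W.card := by
    rw [fix_dom, Finset.card_union_of_disjoint hW.symm]
  have hle : σ.dom.card + W.card ≤ n := by
    have := Finset.card_le_univ (σ.dom ∪ W)
    rw [Finset.card_union_of_disjoint hW.symm, Fintype.card_fin] at this
    exact this
  rw [hcard]
  have e : n - σ.dom.card = W.card + (n - (σ.dom.card + W.card)) := by omega
  rw [e, pow_add, pow_add]
  ring

/-! ### The multi-switching lemma -/

section Main

variable {m : ℕ} (ℓ : ℕ) (F : Fin m → CNF (Fin n)) (t D : ℕ)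

/-- The witness chosen for a bad restriction. [cite: Hastad2014, §3] -/
def badWit (ρ : PAssign n) : List (Segment n m) :=
  if h : 1 ≤ D ∧ D ≤ ccDepth ℓ F n ρ then Classical.choose (exists_witness ℓ F n ρ D h.1 h.2) else []

/-- The chosen witness of a bad restriction is valid, has `D` variables and few segments. [cite: Hastad2014, §3] -/
theorem badWit_spec {ρ : PAssign n} (h1 : 1 ≤ D) (h : D ≤ ccDepth ℓ F n ρ) :
    WitValid ℓ F ρ (badWit ℓ F D ρ) ∧ witLen (badWit ℓ F D ρ) = D ∧
      (badWit ℓ F D ρ).length ≤ (D - 1) / (ℓ + 1) + 1 := by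
  unfold badWit; rw [dif_pos ⟨h1, h⟩]
  exact Classical.choose_spec (exists_witness ℓ F n ρ D h1 h)

/-- The restriction `ρ*` of the encoding. [cite: Beame1994, §3] -/
def badStar (ρ : PAssign n) : PAssign n :=
  ρ.fix (witVars (badWit ℓ F D ρ)).toFinset (starVal (badWit ℓ F D ρ))

/-- The letters of the code of a bad restriction. [cite: Hastad2014, §3] -/
def badLetters (ρ : PAssign n) : List ((Entry t × Bool) × Bool) :=
  flatL (((encWit t ρ.val (badWit ℓ F D ρ)).map Prod.snd).map flatL)

/-- The formula indices of the code of a bad restriction. [cite: Hastad2014, §3] -/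
def badIdx (ρ : PAssign n) : List (Fin m) := (encWit t ρ.val (badWit ℓ F D ρ)).map Prod.fst

/-- Stages of a full canonical path query at least one variable. [folklore] -/
theorem PathValid.stages_ne_nil {Fi : CNF (Fin n)} : ∀ {σ : PAssign n} {P : List (Stage n)},
    PathValid Fi σ P → ∀ st ∈ P, st.vars ≠ []
  | _, [], _, st, hst => absurd hst (by simp)
  | σ, st' :: rest, ⟨_, _, hne, hrest⟩, st, hst => by
    rcases List.mem_cons.1 hst with rfl | hst
    · exact hne
    · exact PathValid.stages_ne_nil hrest st hst

/-- Stages of a valid last path query at least one variable. [folklore] -/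
theorem PathValidLast.stages_ne_nil {Fi : CNF (Fin n)} : ∀ {σ : PAssign n} {P : List (Stage n)},
    PathValidLast Fi σ P → ∀ st ∈ P, st.vars ≠ []
  | _, [], h, _, _ => absurd h id
  | σ, [st'], ⟨_, _, hne⟩, st, hst => by
    simp only [List.mem_singleton] at hst; subst hst; exact hne
  | σ, st' :: st'' :: rest, ⟨_, _, hne, hrest⟩, st, hst => by
    rcases List.mem_cons.1 hst with rfl | hst
    · exact hne
    · exact PathValidLast.stages_ne_nil hrest st hst

/-- The shape of a valid witness: nonempty paths with nonempty stages. [folklore] -/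
theorem WitValid.shape : ∀ {σ : PAssign n} {w : List (Segment n m)}, WitValid ℓ F σ w →
    ∀ seg ∈ w, seg.path ≠ [] ∧ ∀ st ∈ seg.path, st.vars ≠ []
  | σ, [], h, _, _ => absurd h id
  | σ, [seg], h, seg', hseg' => by
    simp only [List.mem_singleton] at hseg'; subst hseg'
    change PathValidLast (F seg'.idx) σ seg'.path at h
    exact ⟨h.ne_nil, h.stages_ne_nil⟩
  | σ, seg :: seg' :: rest, ⟨hP, hlen, hrest⟩, s, hs => by
    rcases List.mem_cons.1 hs with rfl | hs
    · exact ⟨fun h => by rw [h] at hlen; simp at hlen, hP.stages_ne_nil⟩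
    · exact WitValid.shape hrest s hs

/-- The code of a path has one letter per queried variable. [folklore] -/
theorem length_flatL_encPath (β J : Fin n → Bool) : ∀ P : List (Stage n),
    (flatL (encPath t β J P)).length = pathLen P
  | [] => rfl
  | st :: rest => by
    have := length_flatL_encPath β J rest
    rw [length_flatL] at this ⊢
    simp [encPath, encStage] at this ⊢
    simpa [encPath] using this

/-- The code of a witness has one letter per variable. [folklore] -/
theorem length_badLetters_aux (J : Fin n → Bool) : ∀ w : List (Segment n m),
    (flatL (((encWit t J w).map Prod.snd).map flatL)).length = witLen w
  | [] => rfl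
  | seg :: rest => by
    have := length_badLetters_aux J rest
    rw [length_flatL] at this ⊢
    simp only [encWit, List.map_cons, List.map_map, List.sum_cons, witLen, witVars_cons,
      List.length_append, length_pathVars] at this ⊢
    rw [length_flatL_encPath]
    simpa [encWit, List.map_map] using this

/-- **Injectivity of the encoding** on bad restrictions. [cite: Hastad2014, Lemma 3.8] [cite: Beame1994, §3] -/
theorem bad_inj (hF : ∀ i, ∀ C ∈ F i, VarNodup C) (ht : ∀ i, ∀ C ∈ F i, C.length ≤ t) (hD : 1 ≤ D)
    {ρ₁ ρ₂ : PAssign n} (h₁ : D ≤ ccDepth ℓ F n ρ₁) (h₂ : D ≤ ccDepth ℓ F n ρ₂)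
    (hstar : badStar ℓ F D ρ₁ = badStar ℓ F D ρ₂)
    (hidx : ∀ k < (D - 1) / (ℓ + 1) + 1, (badIdx ℓ F t D ρ₁)[k]? = (badIdx ℓ F t D ρ₂)[k]?)
    (hlet : ∀ k < D, (badLetters ℓ F t D ρ₁)[k]? = (badLetters ℓ F t D ρ₂)[k]?) : ρ₁ = ρ₂ := by
  obtain ⟨hv₁, hlen₁, hcnt₁⟩ := badWit_spec ℓ F D hD h₁
  obtain ⟨hv₂, hlen₂, hcnt₂⟩ := badWit_spec ℓ F D hD h₂
  set w₁ := badWit ℓ F D ρ₁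
  set w₂ := badWit ℓ F D ρ₂
  -- the letters agree
  have hL : badLetters ℓ F t D ρ₁ = badLetters ℓ F t D ρ₂ :=
    list_eq_of_getElem?_eq (by rw [badLetters, length_badLetters_aux, hlen₁])
      (by rw [badLetters, length_badLetters_aux, hlen₂]) hlet
  -- hence the bodies agree
  have hshape₁ := WitValid.shape ℓ F hv₁
  have hshape₂ := WitValid.shape ℓ F hv₂
  have hbody : (encWit t ρ₁.val w₁).map Prod.snd = (encWit t ρ₂.val w₂).map Prod.snd := by
    have key : ∀ (ρ : PAssign n) (w : List (Segment n m)), (∀ seg ∈ w, seg.path ≠ [] ∧ ∀ st ∈ seg.path, st.vars ≠ []) →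
        ((unflatL (flatL (((encWit t ρ.val w).map Prod.snd).map flatL))).map unflatL) =
          (encWit t ρ.val w).map Prod.snd := by
      intro ρ w hw
      rw [unflatL_flatL, List.map_map]
      · simp only [encWit, List.map_map]
        apply List.map_congr_left
        intro seg hseg
        simp only [Function.comp_apply]
        apply unflatL_flatL
        intro l hl
        simp only [encPath, List.mem_map] at hl
        obtain ⟨st, hst, rfl⟩ := hl
        simp only [encStage, ne_eq, List.map_eq_nil_iff]
        exact (hw seg hseg).2 st hst
      · intro l hl
        simp only [encWit, List.map_map, List.mem_map, Function.comp_apply] at hl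
        obtain ⟨seg, hseg, rfl⟩ := hl
        apply flatL_ne_nil
        · simp only [encPath, ne_eq, List.map_eq_nil_iff]; exact (hw seg hseg).1
        · intro l hl
          simp only [encPath, List.mem_map] at hl
          obtain ⟨st, hst, rfl⟩ := hl
          simp only [encStage, ne_eq, List.map_eq_nil_iff]
          exact (hw seg hseg).2 st hst
    rw [← key ρ₁ w₁ hshape₁, ← key ρ₂ w₂ hshape₂]
    change (unflatL (badLetters ℓ F t D ρ₁)).map unflatL = (unflatL (badLetters ℓ F t D ρ₂)).map unflatL
    rw [hL]
  -- hence the numbers of segments agree and the indices agree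
  have hr : w₁.length = w₂.length := by
    have := congrArg List.length hbody
    simpa [encWit] using this
  have hI : badIdx ℓ F t D ρ₁ = badIdx ℓ F t D ρ₂ := by
    refine list_eq_of_getElem?_eq (R := (D - 1) / (ℓ + 1) + 1) ?_ ?_ hidx
    · simpa [badIdx, encWit] using hcnt₁
    · simpa [badIdx, encWit] using hcnt₂
  -- hence the codes agree
  have hcode : encWit t ρ₁.val w₁ = encWit t ρ₂.val w₂ := by
    rw [← List.zip_unzip (encWit t ρ₁.val w₁), ← List.zip_unzip (encWit t ρ₂.val w₂)]
    simp only [List.unzip_eq_map]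
    change (badIdx ℓ F t D ρ₁).zip _ = (badIdx ℓ F t D ρ₂).zip _
    rw [hI, hbody]
  -- decode
  have hnd₁ := (WitValid.nodup_free ℓ F hF hv₁).1
  have hnd₂ := (WitValid.nodup_free ℓ F hF hv₂).1
  have d₁ := decWit_encWit ℓ F t hF ht ρ₁.val (starVal w₁) hv₁ (starVal_spec hnd₁) (fun _ _ => rfl)
  have d₂ := decWit_encWit ℓ F t hF ht ρ₂.val (starVal w₂) hv₂ (starVal_spec hnd₂) (fun _ _ => rfl)
  rw [← d₁, ← d₂]
  change decWit F t (badStar ℓ F D ρ₁) _ = decWit F t (badStar ℓ F D ρ₂) _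
  rw [hstar, hcode]

/-- `Entry t` is a product. [folklore] -/
def Entry.equivProd : Entry t ≃ Fin (t + 1) × Bool × Bool × Bool where
  toFun e := (e.pos, e.ans, e.val, e.old)
  invFun q := ⟨q.1, q.2.1, q.2.2.1, q.2.2.2⟩
  left_inv := fun ⟨_, _, _, _⟩ => rfl
  right_inv := fun ⟨_, _, _, _⟩ => rfl

/-- There are `8(t+1)` letters. [folklore] -/
theorem card_Entry : Fintype.card (Entry t) = 8 * (t + 1) := by
  rw [Fintype.card_congr (Entry.equivProd t)]
  simp only [Fintype.card_prod, Fintype.card_fin, Fintype.card_bool]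
  ring

/-- The code of a bad restriction, in a fixed finite type. [cite: Hastad2014, §3] -/
def badCode (ρ : PAssign n) :
    (Fin ((D - 1) / (ℓ + 1) + 1) → Option (Fin m)) × (Fin D → Option ((Entry t × Bool) × Bool)) × PAssign n :=
  (fun k => (badIdx ℓ F t D ρ)[k.val]?, fun k => (badLetters ℓ F t D ρ)[k.val]?, badStar ℓ F D ρ)

/-- **The encoding is injective on bad restrictions.** [cite: Hastad2014, Lemma 3.8] [cite: Beame1994, §3] -/
theorem badCode_injOn (hF : ∀ i, ∀ C ∈ F i, VarNodup C) (ht : ∀ i, ∀ C ∈ F i, C.length ≤ t) (hD : 1 ≤ D) :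
    Set.InjOn (badCode ℓ F t D) (univ.filter fun ρ : PAssign n => D ≤ ccDepth ℓ F n ρ : Finset (PAssign n)) := by
  classical
  intro ρ₁ h₁ ρ₂ h₂ heq
  simp only [Finset.coe_filter, Finset.mem_univ, true_and, Set.mem_setOf_eq] at h₁ h₂
  simp only [badCode, Prod.mk.injEq] at heq
  obtain ⟨hI, hL, hS⟩ := heq
  refine bad_inj ℓ F t D hF ht hD h₁ h₂ hS (fun k hk => ?_) (fun k hk => ?_)
  · exact congrFun hI ⟨k, hk⟩
  · exact congrFun hL ⟨k, hk⟩

/-- The weight of a bad restriction in terms of its `ρ*`. [cite: Beame1994, §3] -/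
theorem rrWeight_bad (hF : ∀ i, ∀ C ∈ F i, VarNodup C) (p : ℝ) (hD : 1 ≤ D) {ρ : PAssign n}
    (h : D ≤ ccDepth ℓ F n ρ) : (1 - p) ^ D * rrWeight p ρ = p ^ D * rrWeight p (badStar ℓ F D ρ) := by
  obtain ⟨hv, hlen, _⟩ := badWit_spec ℓ F D hD h
  have hc := WitValid.card_witVars ℓ F hF hv
  rw [hlen] at hc
  have := rrWeight_fix p ρ hc.2 (starVal (badWit ℓ F D ρ))
  rw [hc.1] at this
  exact this

/-- **Håstad's multi-switching lemma** (Håstad 2014, Lemma 3.8; Tal 2017, Lemma 3.5), counting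
form. Let `F₁, …, F_m` be DNFs over `n` variables whose terms have width `≤ t` and pairwise distinct
variables, `ℓ ≥ 0`, `D ≥ 1`, `0 ≤ p < 1`. The probability under `R_p` that the canonical common
`ℓ`-partial decision tree of `(F_i|ρ)_i` has depth `≥ D` is at most
`(m+1)^{⌊(D-1)/(ℓ+1)⌋+1} · (32(t+1)+1)^D · (p/(1-p))^D`. (Proof: Razborov-style injection
`ρ ↦ (code, ρ*)`; `ρ*` fixes the `D` queried variables so that the decoder recovers the examined
terms one by one; a segment costs a formula index and each variable `32(t+1)+1` letters.) [cite: Hastad2014, Lemma 3.8] -/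
theorem multiSwitching_count (hF : ∀ i, ∀ C ∈ F i, VarNodup C) (ht : ∀ i, ∀ C ∈ F i, C.length ≤ t)
    {p : ℝ} (hp0 : 0 ≤ p) (hp1 : p < 1) (hD : 1 ≤ D) :
    ∑ ρ ∈ univ.filter (fun ρ : PAssign n => D ≤ ccDepth ℓ F n ρ), rrWeight p ρ ≤
      ((m + 1 : ℝ) ^ ((D - 1) / (ℓ + 1) + 1) * (32 * (t + 1) + 1) ^ D) * (p / (1 - p)) ^ D := by
  classical
  set Bad := univ.filter (fun ρ : PAssign n => D ≤ ccDepth ℓ F n ρ) with hBad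
  have h1p : 0 < 1 - p := by linarith
  -- Step 1: transfer the weights to ρ*
  have step1 : ∑ ρ ∈ Bad, rrWeight p ρ = (p / (1 - p)) ^ D * ∑ ρ ∈ Bad, rrWeight p (badStar ℓ F D ρ) := by
    rw [Finset.mul_sum]
    refine Finset.sum_congr rfl fun ρ hρ => ?_
    have hρ' : D ≤ ccDepth ℓ F n ρ := (Finset.mem_filter.1 hρ).2
    have := rrWeight_bad ℓ F D hF p hD hρ'
    rw [div_pow]
    field_simp
    linarith [this]
  -- Step 2: injectivity
  let G : (Fin ((D - 1) / (ℓ + 1) + 1) → Option (Fin m)) × (Fin D → Option ((Entry t × Bool) × Bool)) ×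
      PAssign n → ℝ := fun c => rrWeight p c.2.2
  have step2 : ∑ ρ ∈ Bad, rrWeight p (badStar ℓ F D ρ) = ∑ c ∈ Bad.image (badCode ℓ F t D), G c := by
    rw [Finset.sum_image (badCode_injOn ℓ F t D hF ht hD)]
    rfl
  have step3 : ∑ c ∈ Bad.image (badCode ℓ F t D), G c ≤ ∑ c, G c :=
    Finset.sum_le_sum_of_subset_of_nonneg (Finset.subset_univ _) fun c _ _ => rrWeight_nonneg hp0 hp1.le _
  have step4 : ∑ c, G c = (m + 1 : ℝ) ^ ((D - 1) / (ℓ + 1) + 1) * (32 * (t + 1) + 1) ^ D := by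
    have e1 : ∑ c, G c = ∑ _a : Fin ((D - 1) / (ℓ + 1) + 1) → Option (Fin m),
        ∑ _b : Fin D → Option ((Entry t × Bool) × Bool), ∑ ρ' : PAssign n, rrWeight p ρ' := by
      simp only [G, Fintype.sum_prod_type]
    rw [e1]
    simp only [sum_rrWeight, Finset.sum_const, Finset.card_univ, mul_one, nsmul_eq_mul,
      Fintype.card_fun, Fintype.card_option, Fintype.card_fin, Fintype.card_prod, Fintype.card_bool, card_Entry]
    push_cast
    ring
  rw [step1, step2]
  calc (p / (1 - p)) ^ D * ∑ c ∈ Bad.image (badCode ℓ F t D), G c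
      ≤ (p / (1 - p)) ^ D * ∑ c, G c := mul_le_mul_of_nonneg_left step3 (by positivity)
    _ = _ := by rw [step4]; ring

end Main


/-! ### The multi-switching lemma in the form used for AC⁰ -/

section Corollary

variable {m : ℕ} (ℓ : ℕ) (F : Fin m → CNF (Fin n)) (t D : ℕ)

/-- **Håstad's multi-switching lemma**, usable form: if `m + 1 ≤ 2^{ℓ+1}` and `p ≤ 1/2`, the
probability that the canonical common `ℓ`-partial decision tree of `(F_i|ρ)_{i<m}` has depth `≥ D` is
at most `(m+1) · (132 (t+1) p)^D` (Tal 2017, Lemma 3.5 / Håstad 2014, Lemma 3.8, with explicit —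
not optimised — constants). [cite: Hastad2014, Lemma 3.8] [cite: Tal2017, Lemma 3.5] -/
theorem multiSwitching (hF : ∀ i, ∀ C ∈ F i, VarNodup C) (ht : ∀ i, ∀ C ∈ F i, C.length ≤ t)
    (hm : m + 1 ≤ 2 ^ (ℓ + 1)) {p : ℝ} (hp0 : 0 ≤ p) (hp : p ≤ 1 / 2) (hD : 1 ≤ D) :
    ∑ ρ ∈ univ.filter (fun ρ : PAssign n => D ≤ ccDepth ℓ F n ρ), rrWeight p ρ ≤
      (m + 1 : ℝ) * (132 * (t + 1) * p) ^ D := by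
  have h := multiSwitching_count ℓ F t D hF ht hp0 (by linarith) hD
  refine h.trans ?_
  have hm' : ((m + 1 : ℕ) : ℝ) ^ ((D - 1) / (ℓ + 1)) ≤ 2 ^ (D - 1) := by
    calc ((m + 1 : ℕ) : ℝ) ^ ((D - 1) / (ℓ + 1)) ≤ ((2 ^ (ℓ + 1) : ℕ) : ℝ) ^ ((D - 1) / (ℓ + 1)) :=
          pow_le_pow_left₀ (by positivity) (by exact_mod_cast hm) _
      _ = 2 ^ ((ℓ + 1) * ((D - 1) / (ℓ + 1))) := by push_cast; rw [pow_mul]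
      _ ≤ 2 ^ (D - 1) := pow_le_pow_right₀ (by norm_num) (Nat.mul_div_le (D - 1) (ℓ + 1))
  have hpow : ((m + 1 : ℕ) : ℝ) ^ ((D - 1) / (ℓ + 1) + 1) ≤ (m + 1) * 2 ^ D := by
    rw [pow_succ]
    calc ((m + 1 : ℕ) : ℝ) ^ ((D - 1) / (ℓ + 1)) * ((m + 1 : ℕ) : ℝ) ≤ 2 ^ (D - 1) * (m + 1) := by
          push_cast; exact mul_le_mul_of_nonneg_right (by exact_mod_cast hm') (by positivity)
      _ ≤ 2 ^ D * (m + 1) := by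
          refine mul_le_mul_of_nonneg_right (pow_le_pow_right₀ (by norm_num) (Nat.sub_le D 1)) (by positivity)
      _ = (m + 1) * 2 ^ D := by ring
  have hfrac : (p / (1 - p)) ^ D ≤ (2 * p) ^ D := by
    refine pow_le_pow_left₀ (div_nonneg hp0 (by linarith)) ?_ _
    rw [div_le_iff₀ (by linarith)]
    nlinarith
  have h33 : (32 * (t + 1 : ℝ) + 1) ^ D ≤ (33 * (t + 1)) ^ D :=
    pow_le_pow_left₀ (by positivity) (by linarith) _
  have hCnn : 0 ≤ (p / (1 - p)) ^ D := pow_nonneg (div_nonneg hp0 (by linarith)) _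
  have key : (2 : ℝ) ^ D * (33 * (t + 1)) ^ D * (2 * p) ^ D = (132 * (t + 1) * p) ^ D := by
    rw [← mul_pow, ← mul_pow]; congr 1; ring
  have hpow' : (m + 1 : ℝ) ^ ((D - 1) / (ℓ + 1) + 1) ≤ (m + 1) * 2 ^ D := by exact_mod_cast hpow
  calc ((m + 1 : ℝ) ^ ((D - 1) / (ℓ + 1) + 1) * (32 * (t + 1) + 1) ^ D) * (p / (1 - p)) ^ D
      ≤ ((m + 1) * 2 ^ D * (33 * (t + 1)) ^ D) * (2 * p) ^ D := by
        refine mul_le_mul ?_ hfrac hCnn (by positivity)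
        exact mul_le_mul hpow' h33 (by positivity) (by positivity)
    _ = (m + 1) * ((2 : ℝ) ^ D * (33 * (t + 1)) ^ D * (2 * p) ^ D) := by ring
    _ = (m + 1) * (132 * (t + 1) * p) ^ D := by rw [key]

/-- At a leaf of the canonical common tree (with fuel `n`) every formula has canonical depth `≤ ℓ`. [cite: Hastad2014, §3] -/
theorem cdt_le_of_mem_procLeaves (hF : ∀ i, ∀ C ∈ F i, VarNodup C) (ρ : PAssign n) {τ : PAssign n}
    (hτ : τ ∈ procLeaves (swQuery ℓ F) n ρ) (i : Fin m) : cdt (F i) τ ≤ ℓ := by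
  refine cdt_le_of_swQuery_eq_empty ℓ F hF ?_ i
  refine procLeaves_terminal (swQuery_subset_free ℓ F hF) n ρ ?_ τ hτ
  rw [card_free]; omega

end Corollary

/-! ### Canonical decision trees as decision trees -/

section DTree

/-- Query the variables of a list in order, accumulating the answers, then continue with `k`. [folklore] -/
def queryList : List (Fin n) → ((Fin n → Bool) → DecisionTree n) → (Fin n → Bool) → DecisionTree n
  | [], k, acc => k acc
  | i :: L, k, acc =>
    .query i (queryList L k (Function.update acc i false)) (queryList L k (Function.update acc i true))

/-- The accumulated answers along the path of `x`. [folklore] -/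
def accAnswers : List (Fin n) → (Fin n → Bool) → (Fin n → Bool) → Fin n → Bool
  | [], acc, _ => acc
  | i :: L, acc, x => accAnswers L (Function.update acc i (x i)) x

/-- Querying a list of variables adds its length to the depth. [folklore] -/
theorem depth_queryList_le {k : (Fin n → Bool) → DecisionTree n} {d : ℕ} (hk : ∀ a, (k a).depth ≤ d) :
    ∀ (L : List (Fin n)) (acc : Fin n → Bool), (queryList L k acc).depth ≤ L.length + d
  | [], acc => by simpa [queryList] using hk acc
  | i :: L, acc => by
    simp only [queryList, DecisionTree.depth, List.length_cons]
    have h0 := depth_queryList_le hk L (Function.update acc i false)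
    have h1 := depth_queryList_le hk L (Function.update acc i true)
    omega

/-- Evaluating the block query: the continuation receives the answers of the input. [folklore] -/
theorem eval_queryList (k : (Fin n → Bool) → DecisionTree n) (x : Fin n → Bool) :
    ∀ (L : List (Fin n)) (acc : Fin n → Bool), (queryList L k acc).eval x = (k (accAnswers L acc x)).eval x
  | [], acc => rfl
  | i :: L, acc => by
    simp only [queryList, DecisionTree.eval, accAnswers]
    cases hx : x i
    · simpa using eval_queryList k x L (Function.update acc i false)
    · simpa using eval_queryList k x L (Function.update acc i true)

/-- The accumulated answers agree with the input on the queried variables. [folklore] -/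
theorem accAnswers_of_mem (x : Fin n → Bool) : ∀ (L : List (Fin n)) (acc : Fin n → Bool) {i : Fin n},
    i ∈ L → accAnswers L acc x i = x i
  | [], acc, i, h => absurd h (by simp)
  | j :: L, acc, i, h => by
    simp only [accAnswers]
    by_cases hiL : i ∈ L
    · exact accAnswers_of_mem x L _ hiL
    · have hij : i = j := by simpa [hiL] using h
      subst hij
      rw [accAnswers_of_not_mem x L _ hiL, Function.update_self]
where
  accAnswers_of_not_mem (x : Fin n → Bool) : ∀ (L : List (Fin n)) (acc : Fin n → Bool) {i : Fin n},
      i ∉ L → accAnswers L acc x i = acc i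
    | [], acc, i, _ => rfl
    | j :: L, acc, i, h => by
      simp only [List.mem_cons, not_or] at h
      simp only [accAnswers]
      rw [accAnswers_of_not_mem x L _ h.2, Function.update_of_ne h.1]

/-- A falsified term is false on every restricted input. [folklore] -/
theorem all_eq_false_of_falsified {σ : PAssign n} {C : Clause (Fin n)} (h : Falsified σ C) (x : Fin n → Bool) :
    C.all (Literal.eval (σ.apply x)) = false := by
  obtain ⟨l, hl, hd, hv⟩ := h
  rw [List.all_eq_false]
  refine ⟨l, hl, ?_⟩
  simp only [Literal.eval, apply_apply, if_pos hd]
  simpa using hv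

/-- A live term with no free variable is true on every restricted input. [folklore] -/
theorem all_eq_true_of_live_of_freeVars_nil {σ : PAssign n} {C : Clause (Fin n)} (h : ¬ Falsified σ C)
    (hfree : freeVars σ C = []) (x : Fin n → Bool) : C.all (Literal.eval (σ.apply x)) = true := by
  rw [List.all_eq_true]
  intro l hl
  have hd : l.1 ∈ σ.dom := by
    by_contra hnd
    have : l.1 ∈ freeVars σ C := mem_freeVars.2 ⟨l.2, hl, hnd⟩
    rw [hfree] at this; simp at this
  have hv : σ.val l.1 = l.2 := by
    by_contra hne; exact h ⟨l, hl, hd, hne⟩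
  simp [Literal.eval, apply_apply, hd, hv]

/-- A live term whose free variables are all answered so as to make their literals true is true. [folklore] -/
theorem all_eq_true_of_satOn {σ : PAssign n} {C : Clause (Fin n)} (h : ¬ Falsified σ C) {x : Fin n → Bool}
    (hsat : SatOn C (freeSet σ C) x) : C.all (Literal.eval (σ.apply x)) = true := by
  rw [List.all_eq_true]
  intro l hl
  by_cases hd : l.1 ∈ σ.dom
  · have hv : σ.val l.1 = l.2 := by
      by_contra hne; exact h ⟨l, hl, hd, hne⟩
    simp [Literal.eval, apply_apply, hd, hv]
  · have : l.1 ∈ freeSet σ C := List.mem_toFinset.2 (mem_freeVars.2 ⟨l.2, hl, hd⟩)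
    have := hsat l hl this
    simp [Literal.eval, apply_apply, hd, this]

/-- **Canonical decision trees are decision trees**: if the canonical decision tree of `F|σ` has depth
`≤ ℓ` then `F|σ` is computed by a decision tree of depth `≤ ℓ`. [cite: Beame1994, §3] -/
theorem exists_decisionTree_of_cdtF_le {F : CNF (Fin n)} (hF : ∀ C ∈ F, VarNodup C) :
    ∀ (fuel : ℕ) (σ : PAssign n) (ℓ : ℕ), σ.free.card ≤ fuel → cdtF fuel F σ ≤ ℓ →
      ∃ T : DecisionTree n, T.depth ≤ ℓ ∧ ∀ x, T.eval x = F.evalDNF (σ.apply x)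
  | 0, σ, ℓ, hfree, _ => by
    have h0 : σ.free = ∅ := Finset.card_eq_zero.1 (Nat.le_zero.1 hfree)
    refine ⟨.leaf (F.evalDNF σ.val), Nat.zero_le _, fun x => ?_⟩
    rw [apply_eq_val_of_free_eq_empty h0]; rfl
  | fuel + 1, σ, ℓ, hfree, hcdt => by
    unfold cdtF at hcdt
    cases hC : firstLive F σ with
    | none =>
      refine ⟨.leaf false, Nat.zero_le _, fun x => ?_⟩
      rw [firstLive_eq_none_iff] at hC
      simp only [DecisionTree.eval, CNF.evalDNF]
      symm; rw [List.any_eq_false]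
      intro C hCF
      rw [all_eq_false_of_falsified (hC C hCF) x]
      exact Bool.false_ne_true
    | some C =>
      rw [hC] at hcdt
      simp only at hcdt
      have hlive := (firstLive_eq_some_iff.1 hC).1
      have hCF := mem_of_firstLive hC
      split_ifs at hcdt with hS
      · refine ⟨.leaf true, Nat.zero_le _, fun x => ?_⟩
        simp only [DecisionTree.eval, CNF.evalDNF]
        symm; rw [List.any_eq_true]
        exact ⟨C, hCF, all_eq_true_of_live_of_freeVars_nil hlive (freeSet_eq_empty_iff.1 hS) x⟩
      · -- query the free variables of `C`
        set S := freeSet σ C with hSdef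
        have hSfree : S ⊆ σ.free := freeSet_subset_free σ C
        have hSne : S.Nonempty := Finset.nonempty_iff_ne_empty.2 hS
        have hsub : ∀ a : Fin n → Bool, ¬ SatOn C S a → cdtF fuel F (σ.fix S a) ≤ ℓ - S.card := by
          intro a ha
          have := Finset.le_sup (f := fun a : Fin n → Bool =>
            if SatOn C S a then 0 else cdtF fuel F (σ.fix S a)) (Finset.mem_univ a)
          simp only [if_neg ha] at this
          omega
        have hIH : ∀ a : Fin n → Bool, ∃ T : DecisionTree n, (¬ SatOn C S a → T.depth ≤ ℓ - S.card ∧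
            ∀ x, T.eval x = F.evalDNF ((σ.fix S a).apply x)) := by
          intro a
          by_cases ha : SatOn C S a
          · exact ⟨.leaf true, fun h => absurd ha h⟩
          · have hf : (σ.fix S a).free.card ≤ fuel := by
              have := card_free_fix_lt hSfree hSne a; omega
            obtain ⟨T, hT⟩ := exists_decisionTree_of_cdtF_le hF fuel (σ.fix S a) (ℓ - S.card) hf (hsub a ha)
            exact ⟨T, fun _ => hT⟩
        choose Tf hTf using hIH
        let k : (Fin n → Bool) → DecisionTree n := fun a => if SatOn C S a then .leaf true else Tf a
        have hk : ∀ a, (k a).depth ≤ ℓ - S.card := by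
          intro a; simp only [k]; split_ifs with ha
          · exact Nat.zero_le _
          · exact (hTf a ha).1
        refine ⟨queryList (freeVars σ C) k σ.val, ?_, fun x => ?_⟩
        · refine (depth_queryList_le hk _ _).trans ?_
          have hlen : (freeVars σ C).length = S.card :=
            (List.toFinset_card_of_nodup ((hF C hCF).freeVars_nodup σ)).symm
          have : S.card ≤ ℓ := by omega
          omega
        · rw [eval_queryList]
          set a := accAnswers (freeVars σ C) σ.val x with hadef
          have hax : ∀ i ∈ S, a i = x i := fun i hi =>
            accAnswers_of_mem x _ _ (List.mem_toFinset.1 hi)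
          simp only [k]
          split_ifs with ha
          · simp only [DecisionTree.eval, CNF.evalDNF]
            symm; rw [List.any_eq_true]
            refine ⟨C, hCF, all_eq_true_of_satOn hlive fun l hl hlS => ?_⟩
            rw [← hax l.1 hlS]; exact ha l hl hlS
          · rw [(hTf a ha).2 x, fix_apply_of_agree hSfree hax]

/-- If `cdt F σ ≤ ℓ` then `F|σ` has a decision tree of depth `≤ ℓ`. [cite: Beame1994, §3] -/
theorem exists_decisionTree_of_cdt_le {F : CNF (Fin n)} (hF : ∀ C ∈ F, VarNodup C) {σ : PAssign n} {ℓ : ℕ}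
    (h : cdt F σ ≤ ℓ) : ∃ T : DecisionTree n, T.depth ≤ ℓ ∧ ∀ x, T.eval x = F.evalDNF (σ.apply x) :=
  exists_decisionTree_of_cdtF_le hF n σ ℓ (by rw [card_free]; omega) h

end DTree

end Literature.Computability.Complexity

end
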